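import Literature.MathematicalPhysics.QuantumFieldTheory.Balaban1983to89.B6Prop22DerivMultiLevelTorus
import Literature.MathematicalPhysics.QuantumFieldTheory.Balaban1983to89.B6Prop22AdjMultiLevelBox

/-!
# `Balaban1983to89.B6Prop22AdjMultiLevelTorus` — [B6] PROPOSITION 2.2, THIRD ENTRY OF (2.67) (`|G′∇^{η*}λ|`), FOR THE
GENUINE `k`-LEVEL OPERATOR `G′ = Δ′_a^{−1}` ON THE TORUS `T_η`: `|(G′∇^{η*}λ)(x)| ≤ O(1)L^jη·e^{−½δ₀d(y,y′)}|λ|`,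
`x ∈ B^j(y)`, `supp λ ⊂ B^{j′}(y′)`, with the PERIODIC difference — by the printed route in TRANSPOSED form (the box
lineage's file 9): the left fixed point `G′∂* = G′₀ᵀ∂* + Rᵀ(G′∂*)` (symmetry of `Δ′_a` on the torus), conjugated by the
level weights `L^{j(x)}`, the column smallness of `R` and the chain of Lemma 2.1 on the torus, every transported cube term
read in its translation chart (file T7 of the torus carrier of the multi-level parametrix; no existing module is touched;
no fact is minted)

FRAMING (verbatim cell line):
statement-level skeleton of published theorems with citation tags; proofs where landed; nothing here is a claim about the Yang–Mills mass gap

Source under audit (cell pub-balaban / lit-balaban): T. Bałaban, *Propagators and renormalization transformations for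
lattice gauge theories. II*, Commun. Math. Phys. **96** (1984) 223–250 [`Balaban1984PropagatorsII`, "B6"], p. 224 [PDF 2]
(«we admit the case when some domains Ω_j are equal to T_η»), p. 229–230 [PDF 7–8] (2.36)–(2.44), p. 232 [PDF 10]
(2.49)–(2.55), p. 234 [PDF 12] (2.64)–(2.67), Proposition 2.2 (held text `paper:balaban1984-cmp96-propagators-rt-ii`,
p0002/p0007/p0008/p0010/p0012).  Unit `lit-balaban-p21` (Phase-2 proof seat p21 gen 15), HOME `run/shared/lean/pub/lit-balaban/`,
B6 fold owner r03, referee ref-4.  Box sibling (consumed BY NAME, untouched): `B6Prop22AdjMultiLevelBox` (p21 gen 10: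
`levW`, the majorant calculus `majorant_mul_left`/`hasMajorant_one`/`hasMajorant_diagonal_mul`/`rowSum_le_of_hasMajorant`,
the cube column/entry lemmas `bX_transpose_mulVec_img/off`, `gX_apply_img/off`, `aXt_dMatt_apply(_off)`,
`sOp_majorant`, `tZero_majorant`, `prop22_third_multiLevelBox`).

## WHAT IS PRINTED (p. 234, verbatim up to notation)

«**Proposition 2.2.** If we have (2.1), (2.2) and M is sufficiently large, then the operator G′ = Δ′_a^{−1} (a = 1)
satisfies the inequalities |(G′λ)(x)|, |(∇^η_xG′λ)(x)|, |(G′∇^{η*}λ)(x)|, … ≤ O(1)[(L^jη)², L^jη, L^jη, …]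
·e^{−½δ₀d(y,y′)}|λ|, x ∈ B^j(y) …, y ∈ Λ_j, supp λ ⊂ B^{j′}(y′), y′ ∈ Λ_{j′}. (2.67)» (third entry: the factor «L^jη»).

## WHAT THIS FILE CERTIFIES (kernel-checked; setting of files T1–T6)

For the genuine operator `Δ′_a = mlOpT` of a nested family `D : TDomains d ℓ M_h k P R` on the torus, `G′₀ = gZeroT`,
`R = rT`, `G′ = gmlT`, the periodic difference `∂_μ = dT` (file T6), the level weights `Λ = levW D.toDomains` of the box
lineage, the torus blocks `𝔅` and distance `d_T` of `geomT D`: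
* §2 **`G′ᵀ = G′`** on the torus (`gmlT_transpose`), the TRANSPOSED FIXED POINT `G′∂ᵀ = G′₀ᵀ∂ᵀ + Rᵀ(G′∂ᵀ)`
  (`fixedPoint_transposeT`) and its conjugate `T̃ = T̃₀ + S·T̃`, `T̃ = Λ^{−1}G′∂ᵀ`, `S = Λ^{−1}RᵀΛ` (`fixedPoint_conjT`);
* §3 **THE MAJORANT OF `S` ON THE TORUS** `sOpT_majorant`: `(K′/M_h)·e^{−δ₄d_T/(d+1)}` with `(δ₄, K′)` functions of `d`,
  `ℓ`, windows — the column of every transported term `σ(K(h_□)G′(□)v_□)σ⁻¹` is the column of the box term of the central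
  cube of its chart (`bTt_mulVec`), where the lineage's weighted-`ℓ¹` column bound applies verbatim (`wsum_kComm_le`,
  (2.43)/(2.43)∂*), the level weights read in the chart (`Dc_lev_apply`), at most `3·2^{d+1}` terms per column
  (`mem_keySet_of_bTt_ne_zero`);
* §4 **THE MAJORANT OF `T̃₀ = Λ^{−1}G′₀ᵀ∂ᵀ` ON THE TORUS** `tZeroT_majorant`: `A·e^{−δ₅d_T/(d+1)}` — the periodic difference
  is translation invariant (`reindex_dT`), so `(σh_□G′(□)v_□σ⁻¹)ᵀ∂_Tᵀ = σ[(h_□G′(□)v_□)ᵀ∂_boxᵀ]σ⁻¹` for a central cube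
  (`aTt_mul_dTt`: a wrap inside the chart meets only wall rows, where the term vanishes), and the lineage's product rule on
  the column applies in the chart;
* §5 **PROPOSITION 2.2, THIRD ENTRY, ON THE TORUS** `prop22_third_multiLevelTorus`: there are `δ₀, C, M₀ > 0` and `N₀`
  (functions of `d`, `ℓ`, windows — not of the torus) such that for every `k`, `M_h ≥ 3` with `L·M_h ≥ M₀`, `R ≥ 2L` with
  `RM ≥ N₀ + 1`, torus size `P` (`P_μ ≥ 4`), nested family `D` of domains of the torus, weights in the windows with
  `a_{i+1} = aNext ℓ a_i c_i`, and axis `μ`: `|(G′∂_μᵀλ)(x)| ≤ C·L^{j}·e^{−½δ₀d_T(y,y′)}|λ|` for `x ∈ B^j(y)`,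
  `supp λ ⊂ B^{j′}(y′)` — the conjugated transposed fixed point, the invertibility of `1 − S` from its row sums
  (`B6Prop23Chain.isUnit_one_sub` with (2.61) on the torus), the chain `B6Prop23Chain.majorant_of_fixedPoint_266W` for
  `(1 − S)^{−1} = 1 + (1 − S)^{−1}S`, the left convolution and Lemma 2.1 on the torus (`lemma21_torus`, `α = ½`).

## HONEST SCOPE

As files T1–T6: levels `1 … k` with `Ω₁ = T_η`, `m² = 0`, `M_h ≥ 3`, `P_μ ≥ 4`, the asymmetric partition; lattice units
(`G′` here is `η^{−2}G′` of print and `∂ᵀ = η∇^{η*}`, whence `L^{j}` for «L^jη»); constants existential (functions of `d`,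
`ℓ`, windows).  Only the transposed periodic differences `∂_μᵀ`, `μ = 0 … d`, are certified.  Nothing is inferred from
the manuscript: every step is kernel-checked.
-/

namespace Literature.MathematicalPhysics.QuantumFieldTheory.Balaban1983to89.B6Prop22AdjMultiLevelTorus

open Finset Matrix
open Literature.MathematicalPhysics.QuantumFieldTheory.Balaban1983to89.B4ContourShift (supNorm abs_le_supNorm
  supNorm_nonneg)
open Literature.MathematicalPhysics.QuantumFieldTheory.Balaban1983to89.B4Reflection242 (boxDom mem_boxDom blk nbrs
  mem_nbrs)
open Literature.MathematicalPhysics.QuantumFieldTheory.Balaban1983to89.B4Lemma22ReduceZero (Box)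
open Literature.MathematicalPhysics.QuantumFieldTheory.Balaban1983to89.B4Lemma22ZeroBoxDerivDual (fwd fwd_eq_of_nbr
  fwd_val_of_mem fwd_of_not_mem)
open Literature.MathematicalPhysics.QuantumFieldTheory.Balaban1983to89.B4PartitionUnity22 (hprof D1 D2 D1_nonneg D2_nonneg
  contDiff_hprof hasCompactSupport_hprof)
open Literature.MathematicalPhysics.QuantumFieldTheory.Balaban1983to89.B4Thm110ZeroBox (boxCast boxCast_apply_val
  boxCast_symm_apply_val mem_boxDom_of_eq roww mulVec_le_of_roww)
open Literature.MathematicalPhysics.QuantumFieldTheory.Balaban1983to89.B4Thm110ZeroBoxDeriv (wsum supNorm_single_le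
  supNorm_sub_le_nbr supNorm_nbr_sub_le)
open Literature.MathematicalPhysics.QuantumFieldTheory.Balaban1983to89.B6Ineq243TwoLevelBox
open Literature.MathematicalPhysics.QuantumFieldTheory.Balaban1983to89.B6Ineq243AdjTwoLevelBox (dstar dstar_apply roww_dstar
  ineq243_twoLevel_dstar_roww)
open Literature.MathematicalPhysics.QuantumFieldTheory.Balaban1983to89.B6Partition236TwoLevelBox
open Literature.MathematicalPhysics.QuantumFieldTheory.Balaban1983to89.B6Eq238TwoLevelBox
open Literature.MathematicalPhysics.QuantumFieldTheory.Balaban1983to89.B6Ineq249TwoLevelBox (near card_near_le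
  mem_near_of_abs_lt emb_sub_emb)
open Literature.MathematicalPhysics.QuantumFieldTheory.Balaban1983to89.B6Prop22AdjTwoLevelBox (wsum_kComm_le
  kComm_transpose mul_kComm_apply hLoc_lipschitz hLoc_laplacian_le)
open Literature.MathematicalPhysics.QuantumFieldTheory.Balaban1983to89.B6MultiLevelBoxOperator
open Literature.MathematicalPhysics.QuantumFieldTheory.Balaban1983to89.B6Eq238MultiLevelBox
open Literature.MathematicalPhysics.QuantumFieldTheory.Balaban1983to89.B6Ineq249MultiLevelBox
open Literature.MathematicalPhysics.QuantumFieldTheory.Balaban1983to89.B6Geom246MultiLevelBox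
open Literature.MathematicalPhysics.QuantumFieldTheory.Balaban1983to89.B6Prop22MultiLevelBox
open Literature.MathematicalPhysics.QuantumFieldTheory.Balaban1983to89.B6Prop22DerivMultiLevelBox (dMat
  dMat_mulVec_of_mem dMat_mulVec_of_not_mem img_of_uX_ne_zero mem_keySet_of_uX_ne_zero)
open Literature.MathematicalPhysics.QuantumFieldTheory.Balaban1983to89.B6Prop22AdjMultiLevelBox (levW majorant_mul_left
  hasMajorant_one hasMajorant_diagonal_mul rowSum_le_of_hasMajorant bX_transpose_mulVec_img bX_transpose_mulVec_off
  gX_apply_img gX_apply_off aXt_dMatt_apply aXt_dMatt_apply_off)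
open Literature.MathematicalPhysics.QuantumFieldTheory.Balaban1983to89.B6RandomWalk (HasMajorant BlockSupp
  hasMajorant_mono hasMajorant_mul Triangle254)
open Literature.MathematicalPhysics.QuantumFieldTheory.Balaban1983to89.B6Lemma21Repaired (Ineq261With Ineq263With)
open Literature.MathematicalPhysics.QuantumFieldTheory.Balaban1983to89.B6Ineq261LevelGap (K261 K261_nonneg
  theta_lt_one_of_log)
open Literature.MathematicalPhysics.QuantumFieldTheory.Balaban1983to89.B6Prop23Chain (majorant_of_fixedPoint_266W
  mat isUnit_one_sub)
open Literature.MathematicalPhysics.QuantumFieldTheory.Balaban1983to89.B6MultiLevelTorusOperator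
open Literature.MathematicalPhysics.QuantumFieldTheory.Balaban1983to89.B6Eq238MultiLevelTorus
open Literature.MathematicalPhysics.QuantumFieldTheory.Balaban1983to89.B6Geom246MultiLevelTorus
open Literature.MathematicalPhysics.QuantumFieldTheory.Balaban1983to89.B6Prop22MultiLevelTorus
open Literature.MathematicalPhysics.QuantumFieldTheory.Balaban1983to89.B6Prop22DerivMultiLevelTorus (dT dT_mulVec
  σc_symm_tshift not_interior_of_not_mem not_interior_tshift_of_not_mem uX_central_eq_zero)

noncomputable section

variable {d : ℕ}

/-! ## §1 Tools -/

section Tools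

/-- a sum over a finite type whose non-zero terms are indexed injectively into a finset `T` and are bounded by
`B ≥ 0` is at most `|T|·B`. [folklore] -/
private theorem sum_le_card_mul {ι σ : Type*} [Fintype ι] [DecidableEq σ] (f : ι → ℝ) (key : ι → σ)
    (hkey : Function.Injective key) (T : Finset σ) (hT : ∀ i, f i ≠ 0 → key i ∈ T) {B : ℝ} (hB : 0 ≤ B)
    (hf : ∀ i, f i ≤ B) : ∑ i, f i ≤ T.card * B := by
  classical
  rw [← Finset.sum_filter_ne_zero]
  have hcard : (Finset.univ.filter fun i => f i ≠ 0).card ≤ T.card :=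
    Finset.card_le_card_of_injOn key (fun i hi => by
      rw [Finset.coe_filter] at hi; exact hT i hi.2) (fun i _ j _ h => hkey h)
  calc ∑ i ∈ Finset.univ.filter (fun i => f i ≠ 0), f i
      ≤ (Finset.univ.filter fun i => f i ≠ 0).card • B := Finset.sum_le_card_nsmul _ _ _ fun i _ => hf i
    _ = ((Finset.univ.filter fun i => f i ≠ 0).card : ℝ) * B := by rw [nsmul_eq_mul]
    _ ≤ T.card * B := mul_le_mul_of_nonneg_right (by exact_mod_cast hcard) hB

/-- a weighted `ℓ¹` row bound gives decay against bounded vectors supported at sup-distance `≥ D` from the base point.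
[folklore] -/
private theorem sum_mul_le_of_wrow {X : Type*} [Fintype X] {δ n c F Dd : ℝ} (hn : 0 < n) (hF0 : 0 ≤ F)
    (r u : X → ℝ) (dist : X → ℝ) (hrow : ∑ z, |r z| * Real.exp (δ * dist z / n) ≤ c)
    (hF : ∀ z, |u z| ≤ F) (hD : ∀ z, u z ≠ 0 → Dd ≤ dist z) (hδ : 0 ≤ δ) :
    |∑ z, r z * u z| ≤ c * Real.exp (-(δ * Dd / n)) * F := by
  have hterm : ∀ z, |r z * u z| ≤ |r z| * Real.exp (δ * dist z / n) * (Real.exp (-(δ * Dd / n)) * F) := by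
    intro z
    by_cases hz : u z = 0
    · rw [hz, mul_zero, abs_zero]; positivity
    rw [abs_mul]
    have h1 : 1 ≤ Real.exp (δ * dist z / n) * Real.exp (-(δ * Dd / n)) := by
      rw [← Real.exp_add]
      refine Real.one_le_exp ?_
      have := div_le_div_of_nonneg_right (mul_le_mul_of_nonneg_left (hD z hz) hδ) hn.le
      linarith
    calc |r z| * |u z| ≤ |r z| * (1 * F) := by
          rw [one_mul]; exact mul_le_mul_of_nonneg_left (hF z) (abs_nonneg _)
      _ ≤ |r z| * (Real.exp (δ * dist z / n) * Real.exp (-(δ * Dd / n)) * F) :=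
          mul_le_mul_of_nonneg_left (mul_le_mul_of_nonneg_right h1 hF0) (abs_nonneg _)
      _ = |r z| * Real.exp (δ * dist z / n) * (Real.exp (-(δ * Dd / n)) * F) := by ring
  calc |∑ z, r z * u z| ≤ ∑ z, |r z * u z| := Finset.abs_sum_le_sum_abs _ _
    _ ≤ ∑ z, |r z| * Real.exp (δ * dist z / n) * (Real.exp (-(δ * Dd / n)) * F) :=
        Finset.sum_le_sum fun z _ => hterm z
    _ = (∑ z, |r z| * Real.exp (δ * dist z / n)) * (Real.exp (-(δ * Dd / n)) * F) := by rw [Finset.sum_mul]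
    _ ≤ c * (Real.exp (-(δ * Dd / n)) * F) := mul_le_mul_of_nonneg_right hrow (by positivity)
    _ = c * Real.exp (-(δ * Dd / n)) * F := by ring

/-- the exponent bookkeeping: `e^{−δD/L^i} = e^{δ}·e^{−(δ/(d+1))·dist}` for `D = L^i(dist/(d+1) − 1)`. [folklore] -/
private theorem exp_Dd_eq {δ n dist : ℝ} (hn : 0 < n) (d : ℕ) :
    Real.exp (-(δ * (n * (dist / (d + 1) - 1)) / n)) = Real.exp δ * Real.exp (-(δ / (d + 1) * dist)) := by
  rw [← Real.exp_add]
  congr 1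
  field_simp
  ring

/-- `(reindex e e A)·v` at `z` is `A·(v ∘ e)` at `e⁻¹z`. [folklore] -/
private theorem reindex_mulVec_apply {X Y : Type*} [Fintype X] [Fintype Y] (e : X ≃ Y) (A : Matrix X X ℝ) (v : Y → ℝ)
    (z : Y) : (Matrix.reindex e e A *ᵥ v) z = (A *ᵥ (v ∘ e)) (e.symm z) := by
  rw [Matrix.reindex_apply, Matrix.submatrix_mulVec_equiv, Equiv.symm_symm, Function.comp_apply]

variable {N : Fin (d + 1) → ℕ} in
/-- `mat (toLin' S) = S`. [folklore] -/
private theorem mat_toLin' (S : Matrix ↥(boxDom N) ↥(boxDom N) ℝ) (x z : ↥(boxDom N)) :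
    mat (Matrix.toLin' S) x z = S x z := by
  unfold mat
  rw [Matrix.toLin'_apply, Matrix.mulVec_single_one]
  rfl

variable {ℓ Mh k R : ℕ} {P : Fin (d + 1) → ℕ}

/-- `Λ^{s}Λ^{t} = Λ^{s+t}`. [folklore] -/
private theorem levW_mul (D : Domains d ℓ Mh k P R) (s t : ℤ) : levW D s * levW D t = levW D (s + t) := by
  unfold levW
  rw [Matrix.diagonal_mul_diagonal]
  refine congrArg Matrix.diagonal (funext fun x => ?_)
  have hL : (((ℓ : ℝ) + 1) ^ D.lev x.1) ≠ 0 := by positivity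
  rw [← zpow_add₀ hL]

/-- `Λ^{0} = 1`. [folklore] -/
private theorem levW_zero (D : Domains d ℓ Mh k P R) : levW D 0 = 1 := by
  unfold levW
  simp

/-- `Λ = diag(L^{j(y(x))})`. [folklore] -/
private theorem levW_one_eq (D : Domains d ℓ Mh k P R) :
    levW D 1 = Matrix.diagonal (fun x => ((ℓ : ℝ) + 1) ^ (blkOf D x).1.1) := by
  unfold levW
  refine congrArg Matrix.diagonal (funext fun x => ?_)
  rw [zpow_one]
  rfl

/-- a sum over the box of a function vanishing off the cube image is the sum over the cube. [folklore] -/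
private theorem sum_eq_sum_cube {D : Domains d ℓ Mh k P R} (hP : ∀ μ, 1 ≤ P μ) (cq : ℕ × (Fin (d + 1) → ℤ))
    (hc : CubeData D cq) (Φ : ↥(boxDom (N0 ℓ Mh k P)) → ℝ)
    (h0 : ∀ x', (∀ b, castP (fin_data hc).2.1 hc.hj.2 (embC D hP cq hc b) ≠ x') → Φ x' = 0) :
    ∑ x', Φ x' = ∑ b, Φ (castP (fin_data hc).2.1 hc.hj.2 (embC D hP cq hc b)) := by
  classical
  have hinj : Function.Injective (fun b => castP (fin_data hc).2.1 hc.hj.2 (embC D hP cq hc b)) :=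
    fun b b' h => emb_injective _ hc.hq ((castP (fin_data hc).2.1 hc.hj.2).injective h)
  rw [← Finset.sum_image (f := Φ) (fun b _ b' _ h => hinj h)]
  symm
  refine Finset.sum_subset (Finset.subset_univ _) fun x' _ hx' => h0 x' fun b hb => hx' ?_
  exact Finset.mem_image.2 ⟨b, Finset.mem_univ _, hb⟩

end Tools

/-! ## §2 Symmetry, the transposed fixed point and its conjugate on the torus -/

section FixedPoint

variable {ℓ Mh k R : ℕ} {P : Fin (d + 1) → ℕ}

/-- **`G′ᵀ = G′`** on the torus (`Δ′_a` is symmetric). [cite: Balaban1984PropagatorsII, (2.13)–(2.14) p.225 (quadratic form), dictionary] -/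
theorem gmlT_transpose (N : Fin (d + 1) → ℕ) (ℓ k : ℕ) (lev : (Fin (d + 1) → ℤ) → ℕ) (a : ℕ → ℝ) :
    (gmlT N ℓ k lev a)ᵀ = gmlT N ℓ k lev a :=
  (gmlT_isSymm (N := N) (ℓ := ℓ) (k := k) (lev := lev) (a := a)).eq

/-- **THE TRANSPOSED FIXED POINT `G′∂ᵀ = G′₀ᵀ∂ᵀ + Rᵀ(G′∂ᵀ)`** of (2.38)/(2.50) for the genuine operator on the torus
(transpose `G′ = G′₀ + G′R` and use `G′ᵀ = G′`). [cite: Balaban1984PropagatorsII, (2.38) p.229, (2.50) p.232, (2.66)–(2.67) p.234 (third entry)] -/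
theorem fixedPoint_transposeT (D : TDomains d ℓ Mh k P R) {a c : ℕ → ℝ} (hℓ : 1 ≤ ℓ) (hR : 2 * (ℓ + 1) ≤ R)
    (hP : ∀ μ, 1 ≤ P μ) (hP4 : ∀ μ, 4 ≤ P μ) (hMh : 1 ≤ Mh) (ha : ∀ i, 1 ≤ i → 0 < a i)
    (hcpos : ∀ i, 1 ≤ i → 0 < c i) (hac : ∀ i, 1 ≤ i → a (i + 1) = aNext ℓ (a i) (c i))
    (Dm : Matrix ↥(boxDom (N0 ℓ Mh k P)) ↥(boxDom (N0 ℓ Mh k P)) ℝ) :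
    gmlT (N0 ℓ Mh k P) ℓ k D.lev a * Dm
      = (gZeroT D a c hP hP4)ᵀ * Dm + (rT D a c hP hP4)ᵀ * (gmlT (N0 ℓ Mh k P) ℓ k D.lev a * Dm) := by
  have h238 := eq238_multiLevelTorus (D := D) (a := a) (c := c) hℓ hR hP hP4 hMh ha hcpos hac
  have hGE : gmlT (N0 ℓ Mh k P) ℓ k D.lev a * mlOpT (N0 ℓ Mh k P) ℓ k D.lev a = 1 :=
    gmlT_mul_mlOpT_pos (one_le_N0 hMh hP) D.one_le_lev D.lev_le ha
  have hmat : gmlT (N0 ℓ Mh k P) ℓ k D.lev a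
      = gZeroT D a c hP hP4 + gmlT (N0 ℓ Mh k P) ℓ k D.lev a * rT D a c hP hP4 := by
    have h := congrArg (fun T => gmlT (N0 ℓ Mh k P) ℓ k D.lev a * T) h238
    rw [← Matrix.mul_assoc, hGE, Matrix.one_mul, Matrix.mul_sub, Matrix.mul_one] at h
    rw [h]; abel
  have hT : gmlT (N0 ℓ Mh k P) ℓ k D.lev a
      = (gZeroT D a c hP hP4)ᵀ + (rT D a c hP hP4)ᵀ * gmlT (N0 ℓ Mh k P) ℓ k D.lev a := by
    have h := congrArg Matrix.transpose hmat
    rw [Matrix.transpose_add, Matrix.transpose_mul, gmlT_transpose] at h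
    exact h
  conv_lhs => rw [hT]
  rw [Matrix.add_mul, Matrix.mul_assoc]

/-- **THE CONJUGATED FIXED POINT** `T̃ = T̃₀ + S·T̃` with `T̃ = Λ^{−1}G′∂ᵀ`, `T̃₀ = Λ^{−1}G′₀ᵀ∂ᵀ`, `S = Λ^{−1}RᵀΛ` on the
torus (`Λ = levW D.toDomains`). [cite: Balaban1984PropagatorsII, (2.66)–(2.67) p.234 (third entry), dictionary] -/
theorem fixedPoint_conjT (D : TDomains d ℓ Mh k P R) {a c : ℕ → ℝ} (hℓ : 1 ≤ ℓ) (hR : 2 * (ℓ + 1) ≤ R)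
    (hP : ∀ μ, 1 ≤ P μ) (hP4 : ∀ μ, 4 ≤ P μ) (hMh : 1 ≤ Mh) (ha : ∀ i, 1 ≤ i → 0 < a i)
    (hcpos : ∀ i, 1 ≤ i → 0 < c i) (hac : ∀ i, 1 ≤ i → a (i + 1) = aNext ℓ (a i) (c i))
    (Dm : Matrix ↥(boxDom (N0 ℓ Mh k P)) ↥(boxDom (N0 ℓ Mh k P)) ℝ) :
    levW D.toDomains (-1) * (gmlT (N0 ℓ Mh k P) ℓ k D.lev a * Dm)
      = levW D.toDomains (-1) * ((gZeroT D a c hP hP4)ᵀ * Dm)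
        + (levW D.toDomains (-1) * (rT D a c hP hP4)ᵀ * levW D.toDomains 1)
          * (levW D.toDomains (-1) * (gmlT (N0 ℓ Mh k P) ℓ k D.lev a * Dm)) := by
  have h1 : levW D.toDomains 1 * levW D.toDomains (-1) = 1 := by
    rw [levW_mul]; norm_num; exact levW_zero D.toDomains
  conv_lhs => rw [fixedPoint_transposeT D hℓ hR hP hP4 hMh ha hcpos hac Dm]
  rw [Matrix.mul_add]
  congr 1
  simp only [Matrix.mul_assoc]
  rw [← Matrix.mul_assoc (levW D.toDomains 1), h1, Matrix.one_mul]

end FixedPoint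

/-! ## §3 The majorant of `S = Λ^{−1}RᵀΛ` on the torus -/

section SMajorant

variable {ℓ Mh k R : ℕ} {P : Fin (d + 1) → ℕ} {D : TDomains d ℓ Mh k P R} {a c : ℕ → ℝ}

/-- the chart reads the torus level at the translated point. [cite: Balaban1984PropagatorsII, (2.3)–(2.4) p.224, dictionary] -/
theorem Dc_lev_apply (j : ℕ) (q : Fin (d + 1) → ℤ) (z : ↥(boxDom (N0 ℓ Mh k P))) :
    (Dc D j q).lev z.1 = D.lev (σc ℓ Mh k P j q z).1 := by
  have h := Dc_lev_symm (D := D) j q (σc ℓ Mh k P j q z)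
  rwa [Equiv.symm_apply_apply] at h

/-- **THE COLUMN OF A TRANSPORTED TERM OF `R`** is the column of the box term of the central cube of its chart:
`((σK(h_□)G′(□)v_□σ⁻¹)ᵀf)(x) = ((K(h_□)G′(□)v_□)ᵀ(f∘σ))(σ⁻¹x)`. [cite: Balaban1984PropagatorsII, (2.38) p.229, dictionary] -/
theorem bTt_mulVec (hP : ∀ μ, 1 ≤ P μ) (hP4 : ∀ μ, 4 ≤ P μ) (cq : ℕ × (Fin (d + 1) → ℤ)) (hc : CubeDataT D cq)
    (f : ↥(boxDom (N0 ℓ Mh k P)) → ℝ) (x : ↥(boxDom (N0 ℓ Mh k P))) :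
    ((bT D a c hP hP4 cq hc)ᵀ *ᵥ f) x
      = ((bX (Dc D cq.1 cq.2) a c hP (cq.1, qc ℓ k cq.1 cq.2) (cubeData_chart hP4 hc))ᵀ
          *ᵥ (f ∘ σc ℓ Mh k P cq.1 cq.2)) ((σc ℓ Mh k P cq.1 cq.2).symm x) := by
  unfold bT
  rw [Matrix.transpose_reindex, reindex_mulVec_apply]

/-- a column of a box term of `R` at a site where `h_□ = 0` vanishes (`v_□ = h_□·1_{B^j(Λ_j)}`).
[cite: Balaban1984PropagatorsII, (2.38) p.229, dictionary] -/
theorem bXt_mulVec_eq_zero_of_uX {D' : Domains d ℓ Mh k P R} (hP : ∀ μ, 1 ≤ P μ) (cq : ℕ × (Fin (d + 1) → ℤ))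
    (hc : CubeData D' cq) (f : ↥(boxDom (N0 ℓ Mh k P)) → ℝ) {x : ↥(boxDom (N0 ℓ Mh k P))}
    (hux : uX (ℓ := ℓ) (Mh := Mh) (k := k) (P := P) cq x = 0) : ((bX D' a c hP cq hc)ᵀ *ᵥ f) x = 0 := by
  obtain ⟨hi1, hij, hji, -, -⟩ := fin_data hc
  by_cases himg : ∃ b, embC D' hP cq hc b = (castP (ℓ := ℓ) (Mh := Mh) (P := P) hij hc.hj.2).symm x
  · obtain ⟨b, hb⟩ := himg
    rw [bX_transpose_mulVec_img hP cq hc f hb]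
    have hbx : (embC D' hP cq hc b).1 = x.1 := by
      rw [hb]; unfold castP; exact boxCast_symm_apply_val _ _
    have hv : ((fun z => vFun D' cq.1 cq.2 z.1) ∘ embC D' hP cq hc) b = 0 := by
      have hux' : uFun ℓ Mh cq.1 cq.2 x.1 = 0 := hux
      simp only [Function.comp_apply]
      unfold vFun
      rw [hbx, hux', zero_mul]
    rw [hv, zero_mul]
  · push Not at himg
    exact bX_transpose_mulVec_off hP cq hc f himg

/-- **THE COLUMN SUPPORT OF A TRANSPORTED TERM OF `R`**: a non-zero column at `x` keys the torus cube at `x`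
(`h_□(σ⁻¹x) ≠ 0` in the chart). [cite: Balaban1984PropagatorsII, p.229 (cover of finite overlap), (2.38) p.229] -/
theorem mem_keySet_of_bTt_ne_zero (hℓ : 1 ≤ ℓ) (hR : 2 * (ℓ + 1) ≤ R) (hP : ∀ μ, 1 ≤ P μ) (hP4 : ∀ μ, 4 ≤ P μ)
    (hMh : 1 ≤ Mh) (cq : ℕ × (Fin (d + 1) → ℤ)) (hc : CubeDataT D cq) (f : ↥(boxDom (N0 ℓ Mh k P)) → ℝ)
    {x : ↥(boxDom (N0 ℓ Mh k P))} (hz : ((bT D a c hP hP4 cq hc)ᵀ *ᵥ f) x ≠ 0) :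
    (cq.1, Qmap ℓ Mh k P cq.1 x.1 cq.2) ∈ keySet ℓ Mh (D.lev x.1) x.1 := by
  rw [bTt_mulVec] at hz
  have hux : uX (ℓ := ℓ) (Mh := Mh) (k := k) (P := P) (cq.1, qc ℓ k cq.1 cq.2) ((σc ℓ Mh k P cq.1 cq.2).symm x) ≠ 0 :=
    fun h => hz (bXt_mulVec_eq_zero_of_uX hP _ (cubeData_chart hP4 hc) _ h)
  have hkey := mem_keySet_of_uX_ne_zero hℓ hR hP hMh _ (cubeData_chart hP4 hc) hux
  rw [Dc_lev_symm] at hkey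
  exact mem_keySet_chart hMh hc.hj.2 hkey

/-- **THE MAJORANT OF `S = Λ^{−1}RᵀΛ` FOR THE GENUINE `k`-LEVEL OPERATOR ON THE TORUS**: there are `δ₄, K′ > 0` (functions
of `d`, `ℓ`, windows) such that for every `k`, `M_h ≥ 3`, `R ≥ 2L`, torus size (`P_μ ≥ 4`), nested family `D` of domains
of the torus and weights in the windows, `S` has the majorant `(K′/M_h)·e^{−δ₄d_T(y,y′)/(d+1)}` — the columns of `R` are
`O(1/M)` on the weighted `ℓ¹`, read term by term in the charts. [cite: Balaban1984PropagatorsII, (2.44) p.230, (2.49)/(2.51) p.232, (2.64) p.234] -/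
theorem sOpT_majorant (d ℓ : ℕ) (hℓ : 1 ≤ ℓ) (aminus aplus a2minus a2plus : ℝ) (ha : 0 < aminus) (ha2 : 0 < a2minus) :
    ∃ δ₄ K' : ℝ, 0 < δ₄ ∧ 0 < K' ∧ ∀ (k Mh R : ℕ), 3 ≤ Mh → 2 * (ℓ + 1) ≤ R →
      ∀ (P : Fin (d + 1) → ℕ) (hP : ∀ μ, 1 ≤ P μ) (hP4 : ∀ μ, 4 ≤ P μ) (D : TDomains d ℓ Mh k P R) (a c : ℕ → ℝ),
        (∀ i, 1 ≤ i → aminus ≤ a i ∧ a i ≤ aplus) → (∀ i, 1 ≤ i → a2minus ≤ c i ∧ c i ≤ a2plus) →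
        HasMajorant (g := geomT D) (blkOf D.toDomains)
          (Matrix.toLin' (levW D.toDomains (-1) * (rT D a c hP hP4)ᵀ * levW D.toDomains 1))
          (fun y y' => K' / Mh * Real.exp (-(δ₄ / (d + 1) * (geomT D).dist y y'))) := by
  obtain ⟨δa, c', hδa, hc', h243⟩ := ineq243_twoLevel_roww d ℓ hℓ aminus aplus 0 a2minus a2plus ha ha2
  obtain ⟨δb, cs, hδb, hcs, h243s⟩ := ineq243_twoLevel_dstar_roww d ℓ hℓ aminus aplus 0 a2minus a2plus ha ha2
  have hD1 := D1_nonneg contDiff_hprof hasCompactSupport_hprof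
  have hD2 := D2_nonneg contDiff_hprof hasCompactSupport_hprof
  obtain ⟨δ, hδdef⟩ : ∃ δ : ℝ, δ = min δa δb := ⟨_, rfl⟩
  have hδ0 : 0 < δ := by rw [hδdef]; exact lt_min hδa hδb
  have hδa' : δ ≤ δa := by rw [hδdef]; exact min_le_left _ _
  have hδb' : δ ≤ δb := by rw [hδdef]; exact min_le_right _ _
  have hL0 : (0 : ℝ) < (ℓ : ℝ) + 1 := by positivity
  have hL1 : (1 : ℝ) ≤ (ℓ : ℝ) + 1 := by linarith [(Nat.cast_nonneg ℓ : (0 : ℝ) ≤ ℓ)]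
  obtain ⟨A₁, hA₁⟩ : ∃ A₁ : ℝ, A₁ = (d + 1) * D1 hprof := ⟨_, rfl⟩
  obtain ⟨A₂, hA₂⟩ : ∃ A₂ : ℝ, A₂ = (d + 1) * D2 hprof := ⟨_, rfl⟩
  obtain ⟨ap, hap⟩ : ∃ ap : ℝ, ap = (|aplus| + |a2plus|) * ((ℓ : ℝ) + 1) * Real.exp (δ * ((ℓ : ℝ) + 1)) :=
    ⟨_, rfl⟩
  have hA₁0 : 0 ≤ A₁ := by rw [hA₁]; positivity
  have hA₂0 : 0 ≤ A₂ := by rw [hA₂]; positivity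
  have hap0 : 0 ≤ ap := by rw [hap]; positivity
  obtain ⟨CR₀, hCR₀⟩ : ∃ CR₀ : ℝ, CR₀ = A₁ * ((1 + Real.exp δ) * ((d + 1) * cs)) + (A₂ + ap * A₁) * c' := ⟨_, rfl⟩
  have hCR₀0 : 0 ≤ CR₀ := by rw [hCR₀]; positivity
  refine ⟨δ, 3 * 2 ^ (d + 1) * Real.exp δ * CR₀ + 1, hδ0, by positivity, ?_⟩
  intro k Mh R hMh hR P hP hP4 D a c haw hcw y' lam B hlam x
  have hMh1 : 1 ≤ Mh := le_trans (by norm_num) hMh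
  have hMhr : (1 : ℝ) ≤ Mh := by exact_mod_cast hMh1
  have hB0 : 0 ≤ B := hlam.nonneg
  obtain ⟨M, hM⟩ : ∃ M : ℝ, M = ((ℓ : ℝ) + 1) * Mh := ⟨_, rfl⟩
  have hM1 : (1 : ℝ) ≤ M := by rw [hM]; nlinarith
  have hMpos : 0 < M := by linarith
  rw [Matrix.toLin'_apply, ← Matrix.mulVec_mulVec, ← Matrix.mulVec_mulVec]
  unfold levW
  rw [Matrix.mulVec_diagonal]
  set f : ↥(boxDom (N0 ℓ Mh k P)) → ℝ :=
    Matrix.diagonal (fun x : ↥(boxDom (N0 ℓ Mh k P)) => (((ℓ : ℝ) + 1) ^ D.toDomains.lev x.1) ^ (1 : ℤ)) *ᵥ lam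
    with hfdef
  have hf : ∀ z, f z = ((ℓ : ℝ) + 1) ^ D.lev z.1 * lam z := by
    intro z; rw [hfdef, Matrix.mulVec_diagonal, zpow_one, TDomains.toDomains_lev]
  set dist0 : ℝ := (((bondT D).dist (blkOf D.toDomains x) y' : ℕ) : ℝ) with hdist0
  have hgeom : (geomT D).dist (blkOf D.toDomains x) y' = dist0 := rfl
  have hdist0nn : 0 ≤ dist0 := by positivity
  -- THE BOX LINEAGE'S BOUND OF ONE COLUMN, for ANY family on the fundamental box (file 9's per-cube argument)
  have hbox : ∀ (D' : Domains d ℓ Mh k P R) (y'' : ↥(bset D')) (lam' f' : ↥(boxDom (N0 ℓ Mh k P)) → ℝ),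
      BlockSupp (g := geom D') (blkOf D') lam' y'' B → (∀ z, f' z = ((ℓ : ℝ) + 1) ^ D'.lev z.1 * lam' z) →
      ∀ (x' : ↥(boxDom (N0 ℓ Mh k P))) (cq : ℕ × (Fin (d + 1) → ℤ)) (hc : CubeData D' cq),
        |((bX D' a c hP cq hc)ᵀ *ᵥ f') x'|
          ≤ ((ℓ : ℝ) + 1) ^ (D'.lev x'.1 + 1)
            * (Real.exp δ * (CR₀ / M) * Real.exp (-(δ / (d + 1) * (((bond D').dist (blkOf D' x') y'' : ℕ) : ℝ))) * B) := by
    intro D' y'' lam' f' hlam' hf' x' cq hc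
    have hlamB : ∀ w, |lam' w| ≤ B := fun w => BlockSupp.abs_le hlam' w
    set dist1 : ℝ := (((bond D').dist (blkOf D' x') y'' : ℕ) : ℝ) with hdist1
    set E1 : ℝ := ((ℓ : ℝ) + 1) ^ (D'.lev x'.1 + 1) * (Real.exp δ * (CR₀ / M) * Real.exp (-(δ / (d + 1) * dist1)) * B)
      with hE1
    have hE10 : 0 ≤ E1 := by positivity
    obtain ⟨hi1, hij, hji, -, -⟩ := fin_data hc
    have hjk := hc.hj.2
    by_cases himg : ∃ b, embC D' hP cq hc b = (castP (ℓ := ℓ) (Mh := Mh) (P := P) hij hjk).symm x'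
    swap
    · push Not at himg
      rw [bX_transpose_mulVec_off hP cq hc f' himg, abs_zero]; exact hE10
    obtain ⟨b, hb⟩ := himg
    rw [bX_transpose_mulVec_img hP cq hc f' hb, abs_mul]
    -- the cube data
    have hzval : ∀ w : ↥(boxDom (N0 ℓ Mh k P)), ((castP (ℓ := ℓ) (Mh := Mh) (P := P) hij hjk).symm w).1 = w.1 :=
      fun w => by unfold castP; exact boxCast_symm_apply_val _ _
    have hbx : (embC D' hP cq hc b).1 = x'.1 := by rw [hb, hzval]
    have hxin : InCube ℓ Mh k P cq.1 cq.2 x'.1 := by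
      rw [← hzval x']; exact (inCube_iff_exists_emb (Mh := Mh) hP hij hc.hq _).2 ⟨b, hb⟩
    have hlevwin := lev_window_of_inCube hℓ hR hP hMh1 hc x'.2 hxin
    have hMh' : 1 ≤ MhP ℓ Mh cq.1 (fin D' cq.1 cq.2) := one_le_MhP hMh1 _ _
    have hMhle : Mh ≤ MhP ℓ Mh cq.1 (fin D' cq.1 cq.2) := by
      unfold MhP; exact Nat.le_mul_of_pos_right _ (Nat.one_le_pow _ _ (by omega))
    have hcM' : ∀ ν, 1 ≤ cubeM' (MhP ℓ Mh cq.1 (fin D' cq.1 cq.2)) (Pj ℓ k P cq.1) cq.2 ν := fun ν =>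
      Nat.one_le_iff_ne_zero.2 (Nat.mul_ne_zero_iff.2
        ⟨by omega, by have := (one_le_cubeW (one_le_Pj hP cq.1) hc.hq ν).1; omega⟩)
    have hn1 : 1 ≤ (ℓ + 1) ^ fin D' cq.1 cq.2 := Nat.one_le_pow _ _ (by omega)
    have hn : (0 : ℝ) < (((ℓ + 1) ^ fin D' cq.1 cq.2 : ℕ) : ℝ) := by positivity
    have haj : 0 < a (fin D' cq.1 cq.2) := lt_of_lt_of_le ha (haw _ hi1).1
    have ha0 : 0 ≤ c (fin D' cq.1 cq.2) := (lt_of_lt_of_le ha2 (hcw _ hi1).1).le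
    set Dd : ℝ := (((ℓ + 1) ^ fin D' cq.1 cq.2 : ℕ) : ℝ) * (dist1 / (d + 1) - 1) with hDd
    -- `|v_□| ≤ 1`
    have hw : |((fun z => vFun D' cq.1 cq.2 z.1) ∘ embC D' hP cq hc) b| ≤ 1 := abs_vFun_le_one _ _ _
    -- the weighted `ℓ¹` of the column: the three terms of (2.40)
    obtain ⟨M', hM'⟩ : ∃ M' : ℝ, M' = ((ℓ : ℝ) + 1) * (MhP ℓ Mh cq.1 (fin D' cq.1 cq.2) : ℝ) := ⟨_, rfl⟩
    have hMM' : M ≤ M' := by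
      rw [hM, hM']; exact mul_le_mul_of_nonneg_left (by exact_mod_cast hMhle) hL0.le
    have hM'pos : 0 < M' := lt_of_lt_of_le hMpos hMM'
    obtain ⟨κ₁, hκ₁⟩ : ∃ κ₁ : ℝ, κ₁ = A₁ / M' := ⟨_, rfl⟩
    obtain ⟨κ₂, hκ₂⟩ : ∃ κ₂ : ℝ, κ₂ = (d + 1) * (D2 hprof / M' ^ 2) := ⟨_, rfl⟩
    have hκ₁0 : 0 ≤ κ₁ := by rw [hκ₁]; positivity
    have hκ₂0 : 0 ≤ κ₂ := by rw [hκ₂]; positivity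
    have hK := wsum_kComm_le hn1 haj ha0 (m2 := 0) (κ₂ := κ₂)
      (isBlockUnion_lamLoc (one_le_Pj hP cq.1) hc.hq (isBlockUnion_LamG (D := D') hij hjk)) hδ0.le hκ₁0
      (hLoc ℓ (fin D' cq.1 cq.2) (MhP ℓ Mh cq.1 (fin D' cq.1 cq.2)) (Pj ℓ k P cq.1) cq.2)
      (fun z z' => by rw [hκ₁, hA₁, hM']; exact hLoc_lipschitz hMh' cq.2 z z')
      (fun z => by rw [hκ₂, hM']; exact hLoc_laplacian_le hℓ hi1 hMh' (one_le_Pj hP cq.1) hc.hq z)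
      (fun z' => cG D' a c cq.1 (fin D' cq.1 cq.2) cq.2 hP hc.hq b z') b
    have hsumGD : ∑ μ : Fin (d + 1), wsum δ ((ℓ + 1) ^ fin D' cq.1 cq.2) b (fun z => ((((ℓ + 1) ^ fin D' cq.1 cq.2 : ℕ)) : ℝ)
        * (cG D' a c cq.1 (fin D' cq.1 cq.2) cq.2 hP hc.hq b (fwd _ μ z) - cG D' a c cq.1 (fin D' cq.1 cq.2) cq.2 hP hc.hq b z))
        ≤ (d + 1) * cs := by
      calc ∑ μ : Fin (d + 1), wsum δ ((ℓ + 1) ^ fin D' cq.1 cq.2) b (fun z => ((((ℓ + 1) ^ fin D' cq.1 cq.2 : ℕ)) : ℝ)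
            * (cG D' a c cq.1 (fin D' cq.1 cq.2) cq.2 hP hc.hq b (fwd _ μ z) - cG D' a c cq.1 (fin D' cq.1 cq.2) cq.2 hP hc.hq b z))
          ≤ ∑ _μ : Fin (d + 1), cs := Finset.sum_le_sum fun μ _ => by
            have := (roww_mono hδb' _ _ _).trans (h243s (fin D' cq.1 cq.2) hi1 (a (fin D' cq.1 cq.2)) 0
              (c (fin D' cq.1 cq.2)) (haw _ hi1).1 (haw _ hi1).2 le_rfl le_rfl (hcw _ hi1).1 (hcw _ hi1).2 _ hcM'
              (lamLoc ℓ (MhP ℓ Mh cq.1 (fin D' cq.1 cq.2)) (Pj ℓ k P cq.1) cq.2 (one_le_Pj hP cq.1) hc.hq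
                (LamG D' cq.1 (fin D' cq.1 cq.2))) μ b)
            rw [roww_dstar] at this
            exact this
        _ = (d + 1) * cs := by
            rw [Finset.sum_const, Finset.card_univ, Fintype.card_fin, nsmul_eq_mul]; push_cast; ring
    have hG0 : wsum δ ((ℓ + 1) ^ fin D' cq.1 cq.2) b (fun z' => cG D' a c cq.1 (fin D' cq.1 cq.2) cq.2 hP hc.hq b z') ≤ c' :=
      (roww_mono hδa' _ _ _).trans (h243 (fin D' cq.1 cq.2) hi1 (a (fin D' cq.1 cq.2)) 0 (c (fin D' cq.1 cq.2))
        (haw _ hi1).1 (haw _ hi1).2 le_rfl le_rfl (hcw _ hi1).1 (hcw _ hi1).2 _ hcM' _ b)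
    have hco : 0 ≤ κ₂ + (a (fin D' cq.1 cq.2) + c (fin D' cq.1 cq.2)) * ((ℓ : ℝ) + 1) * Real.exp (δ * ((ℓ : ℝ) + 1)) * κ₁ := by
      positivity
    have hwsum : wsum δ ((ℓ + 1) ^ fin D' cq.1 cq.2) b
        (fun z => (kComm (cOp D' a c cq.1 (fin D' cq.1 cq.2) cq.2 hP hc.hq)
          (hLoc ℓ (fin D' cq.1 cq.2) (MhP ℓ Mh cq.1 (fin D' cq.1 cq.2)) (Pj ℓ k P cq.1) cq.2)
          *ᵥ (fun z' => cG D' a c cq.1 (fin D' cq.1 cq.2) cq.2 hP hc.hq b z')) z) ≤ CR₀ / M := by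
      have t1 := mul_le_mul_of_nonneg_left hsumGD (mul_nonneg hκ₁0 (by positivity : (0 : ℝ) ≤ 1 + Real.exp δ))
      have t2 := mul_le_mul_of_nonneg_left hG0 hco
      refine (hK.trans (add_le_add t1 t2)).trans ?_
      have hκ₁' : κ₁ ≤ A₁ / M := by rw [hκ₁]; exact div_le_div_of_nonneg_left hA₁0 hMpos hMM'
      have hκ₂' : κ₂ ≤ A₂ / M := by
        rw [hκ₂, hA₂]
        have hM'1 : (1 : ℝ) ≤ M' := hM1.trans hMM'
        have hM2 : D2 hprof / M' ^ 2 ≤ D2 hprof / M := by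
          apply div_le_div_of_nonneg_left hD2 hMpos
          calc M ≤ M' := hMM'
            _ = M' * 1 := (mul_one _).symm
            _ ≤ M' * M' := mul_le_mul_of_nonneg_left hM'1 hM'pos.le
            _ = M' ^ 2 := (sq _).symm
        calc ((d : ℝ) + 1) * (D2 hprof / M' ^ 2) ≤ (d + 1) * (D2 hprof / M) :=
              mul_le_mul_of_nonneg_left hM2 (by positivity)
          _ = (d + 1) * D2 hprof / M := mul_div_assoc' _ _ _
      have hajp : (a (fin D' cq.1 cq.2) + c (fin D' cq.1 cq.2)) * ((ℓ : ℝ) + 1) * Real.exp (δ * ((ℓ : ℝ) + 1)) ≤ ap := by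
        rw [hap]
        have : a (fin D' cq.1 cq.2) + c (fin D' cq.1 cq.2) ≤ |aplus| + |a2plus| :=
          add_le_add ((haw _ hi1).2.trans (le_abs_self _)) ((hcw _ hi1).2.trans (le_abs_self _))
        exact mul_le_mul_of_nonneg_right (mul_le_mul_of_nonneg_right this hL0.le) (Real.exp_pos _).le
      have h1 : (κ₂ + (a (fin D' cq.1 cq.2) + c (fin D' cq.1 cq.2)) * ((ℓ : ℝ) + 1) * Real.exp (δ * ((ℓ : ℝ) + 1)) * κ₁) * c'
          ≤ (A₂ / M + ap * (A₁ / M)) * c' :=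
        mul_le_mul_of_nonneg_right (add_le_add hκ₂' (mul_le_mul hajp hκ₁' hκ₁0 hap0)) hc'.le
      have h0 : κ₁ * (1 + Real.exp δ) * ((d + 1) * cs) ≤ A₁ / M * (1 + Real.exp δ) * ((d + 1) * cs) :=
        mul_le_mul_of_nonneg_right (mul_le_mul_of_nonneg_right hκ₁' (by positivity)) (by positivity)
      have h2 : A₁ / M * (1 + Real.exp δ) * ((d + 1) * cs) + (A₂ / M + ap * (A₁ / M)) * c' = CR₀ / M := by
        rw [hCR₀]; field_simp
      rw [← h2]
      exact add_le_add h0 h1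
    -- the vector `z ↦ f′(□-image of z)`: bound `L^{lev x′ + 1}·B` and support distance `Dd`
    have hF : ∀ z, |f' (castP (fin_data hc).2.1 hc.hj.2 (embC D' hP cq hc z))| ≤ ((ℓ : ℝ) + 1) ^ (D'.lev x'.1 + 1) * B := by
      intro z
      rw [hf', abs_mul, abs_of_nonneg (by positivity)]
      set x'' : ↥(boxDom (N0 ℓ Mh k P)) := castP (fin_data hc).2.1 hc.hj.2 (embC D' hP cq hc z) with hx''
      have hx''val : x''.1 = (embC D' hP cq hc z).1 := by rw [hx'']; unfold castP; exact boxCast_apply_val _ _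
      have hx''in : InCube ℓ Mh k P cq.1 cq.2 x''.1 := by
        rw [hx''val]; exact (inCube_iff_exists_emb (Mh := Mh) hP hij hc.hq _).2 ⟨z, rfl⟩
      have hlev'' := lev_window_of_inCube hℓ hR hP hMh1 hc x''.2 hx''in
      have hpow : ((ℓ : ℝ) + 1) ^ D'.lev x''.1 ≤ ((ℓ : ℝ) + 1) ^ (D'.lev x'.1 + 1) :=
        pow_le_pow_right₀ hL1 (by omega)
      exact mul_le_mul hpow (hlamB _) (abs_nonneg _) (by positivity)
    have hD : ∀ z, f' (castP (fin_data hc).2.1 hc.hj.2 (embC D' hP cq hc z)) ≠ 0 → Dd ≤ supNorm (b.1 - z.1) := by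
      intro z hz
      set x'' : ↥(boxDom (N0 ℓ Mh k P)) := castP (fin_data hc).2.1 hc.hj.2 (embC D' hP cq hc z) with hx''
      have hμx : lam' x'' ≠ 0 := by
        intro h0; apply hz; rw [hf', h0, mul_zero]
      have hx''val : x''.1 = (embC D' hP cq hc z).1 := by rw [hx'']; unfold castP; exact boxCast_apply_val _ _
      have hx''in : InCube ℓ Mh k P cq.1 cq.2 x''.1 := by
        rw [hx''val]; exact (inCube_iff_exists_emb (Mh := Mh) hP hij hc.hq _).2 ⟨z, rfl⟩
      have hblk : blkOf D' x'' = y'' := by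
        by_contra hne; exact hμx (hlam'.off x'' hne)
      have h := Dd_le_supNorm hℓ hR hP hMh1 hc x' x'' hxin hx''in y'' hblk
      have hsub : x'.1 - x''.1 = b.1 - z.1 := by
        rw [hx''val, ← hbx]; unfold embC; exact emb_sub_emb _ hc.hq b z
      rw [hsub] at h
      exact h
    have hcol := sum_mul_le_of_wrow hn (by positivity)
      (fun z => (kComm (cOp D' a c cq.1 (fin D' cq.1 cq.2) cq.2 hP hc.hq)
          (hLoc ℓ (fin D' cq.1 cq.2) (MhP ℓ Mh cq.1 (fin D' cq.1 cq.2)) (Pj ℓ k P cq.1) cq.2)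
          *ᵥ (fun z' => cG D' a c cq.1 (fin D' cq.1 cq.2) cq.2 hP hc.hq b z')) z)
      (fun z => f' (castP (fin_data hc).2.1 hc.hj.2 (embC D' hP cq hc z)))
      (fun z => supNorm (b.1 - z.1)) hwsum hF hD hδ0.le
    have hexp : Real.exp (-(δ * Dd / (((ℓ + 1) ^ fin D' cq.1 cq.2 : ℕ) : ℝ)))
        = Real.exp δ * Real.exp (-(δ / (d + 1) * dist1)) := by rw [hDd]; exact exp_Dd_eq hn d
    rw [hexp] at hcol
    rw [hE1]
    calc |((fun z => vFun D' cq.1 cq.2 z.1) ∘ embC D' hP cq hc) b|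
          * |∑ z, (kComm (cOp D' a c cq.1 (fin D' cq.1 cq.2) cq.2 hP hc.hq)
              (hLoc ℓ (fin D' cq.1 cq.2) (MhP ℓ Mh cq.1 (fin D' cq.1 cq.2)) (Pj ℓ k P cq.1) cq.2)
              *ᵥ (fun z' => cG D' a c cq.1 (fin D' cq.1 cq.2) cq.2 hP hc.hq b z')) z
              * f' (castP (fin_data hc).2.1 hc.hj.2 (embC D' hP cq hc z))|
        ≤ 1 * (CR₀ / M * (Real.exp δ * Real.exp (-(δ / (d + 1) * dist1))) * (((ℓ : ℝ) + 1) ^ (D'.lev x'.1 + 1) * B)) :=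
          mul_le_mul hw hcol (abs_nonneg _) zero_le_one
      _ = ((ℓ : ℝ) + 1) ^ (D'.lev x'.1 + 1) * (Real.exp δ * (CR₀ / M) * Real.exp (-(δ / (d + 1) * dist1)) * B) := by
          ring
  -- the bound of one TORUS column: the box bound in its chart
  set E : ℝ := ((ℓ : ℝ) + 1) ^ (D.lev x.1 + 1) * (Real.exp δ * (CR₀ / M) * Real.exp (-(δ / (d + 1) * dist0)) * B)
    with hE
  have hE0 : 0 ≤ E := by positivity
  have hterm : ∀ (cq : ℕ × (Fin (d + 1) → ℤ)) (hc : CubeDataT D cq), |((bT D a c hP hP4 cq hc)ᵀ *ᵥ f) x| ≤ E := by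
    intro cq hc
    rw [bTt_mulVec]
    obtain ⟨b, hb⟩ := blkMap_surjective (D := D) hMh1 hP (svec ℓ k cq.1 cq.2) y'
    have hμ' : BlockSupp (g := geom (Dc D cq.1 cq.2)) (blkOf (Dc D cq.1 cq.2)) (lam ∘ σc ℓ Mh k P cq.1 cq.2) b B :=
      blockSupp_chart hMh1 hP (svec ℓ k cq.1 cq.2) hlam hb
    have hf' : ∀ z, (f ∘ σc ℓ Mh k P cq.1 cq.2) z
        = ((ℓ : ℝ) + 1) ^ (Dc D cq.1 cq.2).lev z.1 * (lam ∘ σc ℓ Mh k P cq.1 cq.2) z := by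
      intro z
      rw [Function.comp_apply, Function.comp_apply, hf, Dc_lev_apply]
    have h := hbox (Dc D cq.1 cq.2) b (lam ∘ σc ℓ Mh k P cq.1 cq.2) (f ∘ σc ℓ Mh k P cq.1 cq.2) hμ' hf'
      ((σc ℓ Mh k P cq.1 cq.2).symm x) (cq.1, qc ℓ k cq.1 cq.2) (cubeData_chart hP4 hc)
    rw [Dc_lev_symm] at h
    refine h.trans ?_
    have hd : dist0 ≤ (((bond (Dc D cq.1 cq.2)).dist (blkOf (Dc D cq.1 cq.2) ((σc ℓ Mh k P cq.1 cq.2).symm x)) b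
        : ℕ) : ℝ) := by
      rw [hdist0, ← hb]
      exact_mod_cast distT_blkOf_le_chart hMh1 hP (svec ℓ k cq.1 cq.2) x b
    rw [hE]
    have hexp : Real.exp (-(δ / (d + 1) * (((bond (Dc D cq.1 cq.2)).dist
          (blkOf (Dc D cq.1 cq.2) ((σc ℓ Mh k P cq.1 cq.2).symm x)) b : ℕ) : ℝ)))
        ≤ Real.exp (-(δ / (d + 1) * dist0)) := by
      rw [Real.exp_le_exp, neg_le_neg_iff]
      exact mul_le_mul_of_nonneg_left hd (by positivity)
    have h0 : 0 ≤ Real.exp δ * (CR₀ / M) := by positivity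
    exact mul_le_mul_of_nonneg_left (mul_le_mul_of_nonneg_right (mul_le_mul_of_nonneg_left hexp h0) hB0)
      (by positivity)
  -- summing over the cover: only members keyed at `x`
  rw [abs_mul]
  have hpow : |((((ℓ : ℝ) + 1) ^ D.toDomains.lev x.1) ^ (-1 : ℤ))| = (((ℓ : ℝ) + 1) ^ D.lev x.1)⁻¹ := by
    rw [_root_.zpow_neg_one, abs_of_nonneg (by positivity), TDomains.toDomains_lev]
  rw [hpow]
  unfold rT
  rw [Matrix.transpose_sum, Matrix.sum_mulVec, Finset.sum_apply, Finset.attach_eq_univ]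
  have key := sum_le_card_mul
    (fun cq : {cq // cq ∈ cubeSetT D} => |((bT D a c hP hP4 cq.1 (cubeDataT_of_mem cq.2))ᵀ *ᵥ f) x|)
    (fun cq => (cq.1.1, Qmap ℓ Mh k P cq.1.1 x.1 cq.1.2)) (keyT_injective D x.1) (keySet ℓ Mh (D.lev x.1) x.1)
    (fun cq hq0 => mem_keySet_of_bTt_ne_zero hℓ hR hP hP4 hMh1 cq.1 (cubeDataT_of_mem cq.2) f
      (fun h0 => hq0 (by rw [h0, abs_zero])))
    hE0 (fun cq => hterm cq.1 (cubeDataT_of_mem cq.2))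
  refine (mul_le_mul_of_nonneg_left ((Finset.abs_sum_le_sum_abs _ _).trans key) (by positivity)).trans ?_
  have hcard : ((keySet ℓ Mh (D.lev x.1) x.1).card : ℝ) ≤ 3 * 2 ^ (d + 1) := by
    exact_mod_cast card_keySet_le _ _ _ _
  dsimp only
  rw [hgeom]
  have hLM : ((ℓ : ℝ) + 1) / M = 1 / Mh := by rw [hM, div_mul_eq_div_div, div_self hL0.ne']
  have hrest : 0 ≤ Real.exp (-(δ / (d + 1) * dist0)) * B := by positivity
  have hMh0 : (0 : ℝ) < Mh := by linarith
  calc (((ℓ : ℝ) + 1) ^ D.lev x.1)⁻¹ * (((keySet ℓ Mh (D.lev x.1) x.1).card : ℝ) * E)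
      ≤ (((ℓ : ℝ) + 1) ^ D.lev x.1)⁻¹ * (3 * 2 ^ (d + 1) * E) :=
        mul_le_mul_of_nonneg_left (mul_le_mul_of_nonneg_right hcard hE0) (by positivity)
    _ = 3 * 2 ^ (d + 1) * Real.exp δ * CR₀ * (((ℓ : ℝ) + 1) / M) * (Real.exp (-(δ / (d + 1) * dist0)) * B) := by
        rw [hE]
        field_simp
        ring
    _ = 3 * 2 ^ (d + 1) * Real.exp δ * CR₀ / Mh * (Real.exp (-(δ / (d + 1) * dist0)) * B) := by
        rw [hLM]; ring
    _ ≤ (3 * 2 ^ (d + 1) * Real.exp δ * CR₀ + 1) / Mh * (Real.exp (-(δ / (d + 1) * dist0)) * B) :=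
        mul_le_mul_of_nonneg_right (div_le_div_of_nonneg_right (by linarith) hMh0.le) hrest
    _ = (3 * 2 ^ (d + 1) * Real.exp δ * CR₀ + 1) / Mh * Real.exp (-(δ / (d + 1) * dist0)) * B := by ring

end SMajorant

/-! ## §4 The majorant of `T̃₀ = Λ^{−1}G′₀ᵀ∂ᵀ` on the torus -/

section TZeroMajorant

variable {ℓ Mh k R : ℕ} {P : Fin (d + 1) → ℕ} {D : TDomains d ℓ Mh k P R} {a c : ℕ → ℝ}

/-- **THE PERIODIC DIFFERENCE IS TRANSLATION INVARIANT**: `σ∂_μσ⁻¹ = ∂_μ` for every chart translation `σ`.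
[cite: Balaban1983RegularityDecay, p.572 («a torus T_η … with periodic conditions»), dictionary] -/
theorem reindex_dT (j : ℕ) (q : Fin (d + 1) → ℤ) (μ : Fin (d + 1)) :
    Matrix.reindex (σc ℓ Mh k P j q) (σc ℓ Mh k P j q) (dT (N0 ℓ Mh k P) μ) = dT (N0 ℓ Mh k P) μ := by
  ext x y
  rw [Matrix.reindex_apply, Matrix.submatrix_apply]
  unfold dT shiftMat
  rw [Matrix.sub_apply, Matrix.sub_apply, Matrix.one_apply, Matrix.one_apply, ← σc_symm_tshift]
  simp only [Equiv.apply_eq_iff_eq]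

/-- **THE TRANSPOSED TRANSPORTED TERM AGAINST THE PERIODIC DIFFERENCE IS THE TRANSPORTED BOX QUANTITY**:
`(σh_□G′(□)v_□σ⁻¹)ᵀ∂_Tᵀ = σ[(h_□G′(□)v_□)ᵀ∂_boxᵀ]σ⁻¹` for the central cube of the chart (a wrap inside the chart meets
only wall rows of the box term, which vanish). [cite: Balaban1984PropagatorsII, (2.37) p.229, (2.67) p.234 (third entry), dictionary] -/
theorem aTt_mul_dTt (hMh : 1 ≤ Mh) (hP : ∀ μ, 1 ≤ P μ) (hP4 : ∀ μ, 4 ≤ P μ) (cq : ℕ × (Fin (d + 1) → ℤ))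
    (hc : CubeDataT D cq) (μ : Fin (d + 1)) :
    (aT D a c hP hP4 cq hc)ᵀ * (dT (N0 ℓ Mh k P) μ)ᵀ
      = Matrix.reindex (σc ℓ Mh k P cq.1 cq.2) (σc ℓ Mh k P cq.1 cq.2)
          ((aX (Dc D cq.1 cq.2) a c hP (cq.1, qc ℓ k cq.1 cq.2) (cubeData_chart hP4 hc))ᵀ
            * (dMat (N0 ℓ Mh k P) μ)ᵀ) := by
  -- the box identity `(aX_c)ᵀ∂_Tᵀ = (aX_c)ᵀ∂_boxᵀ` for the central cube
  have hbox : (aX (Dc D cq.1 cq.2) a c hP (cq.1, qc ℓ k cq.1 cq.2) (cubeData_chart hP4 hc))ᵀ * (dT (N0 ℓ Mh k P) μ)ᵀ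
      = (aX (Dc D cq.1 cq.2) a c hP (cq.1, qc ℓ k cq.1 cq.2) (cubeData_chart hP4 hc))ᵀ * (dMat (N0 ℓ Mh k P) μ)ᵀ := by
    ext x x'
    have hcol : ∀ Bm : Matrix ↥(boxDom (N0 ℓ Mh k P)) ↥(boxDom (N0 ℓ Mh k P)) ℝ,
        ((aX (Dc D cq.1 cq.2) a c hP (cq.1, qc ℓ k cq.1 cq.2) (cubeData_chart hP4 hc))ᵀ * Bmᵀ) x x'
          = (Bm *ᵥ (fun w => aX (Dc D cq.1 cq.2) a c hP (cq.1, qc ℓ k cq.1 cq.2) (cubeData_chart hP4 hc) w x)) x' := by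
      intro Bm
      simp only [Matrix.mul_apply, Matrix.transpose_apply, Matrix.mulVec, dotProduct]
      exact Finset.sum_congr rfl fun w _ => mul_comm _ _
    rw [hcol, hcol, dT_mulVec]
    by_cases hxe : x'.1 + Pi.single μ 1 ∈ boxDom (N0 ℓ Mh k P)
    · rw [dMat_mulVec_of_mem μ hxe]
      have h : tshift (N0 ℓ Mh k P) (unitVec μ) x' = ⟨x'.1 + Pi.single μ 1, hxe⟩ :=
        Subtype.ext (tshift_val_of_mem hxe)
      rw [h]
    · rw [dMat_mulVec_of_not_mem μ hxe, aX_wall_row hMh hP hP4 hc _ (not_interior_tshift_of_not_mem hxe),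
        aX_wall_row hMh hP hP4 hc _ (not_interior_of_not_mem hxe), sub_zero]
  unfold aT
  rw [Matrix.transpose_reindex, ← hbox]
  conv_lhs => rw [← reindex_dT (ℓ := ℓ) (Mh := Mh) (k := k) (P := P) cq.1 cq.2 μ]
  rw [Matrix.transpose_reindex, Matrix.reindex_apply, Matrix.reindex_apply, Matrix.reindex_apply]
  exact Matrix.submatrix_mul_equiv _ _ _ _ _

/-- a box term of `G′₀ᵀ∂ᵀ` whose row index has `h_□(x) = 0` vanishes against any vector. [cite: Balaban1984PropagatorsII, (2.37) p.229, dictionary] -/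
theorem aXt_dMatt_mulVec_eq_zero {D' : Domains d ℓ Mh k P R} (hP : ∀ μ, 1 ≤ P μ) (cq : ℕ × (Fin (d + 1) → ℤ))
    (hc : CubeData D' cq) (μ : Fin (d + 1)) (lam : ↥(boxDom (N0 ℓ Mh k P)) → ℝ) {x : ↥(boxDom (N0 ℓ Mh k P))}
    (hux : uX (ℓ := ℓ) (Mh := Mh) (k := k) (P := P) cq x = 0) :
    (((aX D' a c hP cq hc)ᵀ * (dMat (N0 ℓ Mh k P) μ)ᵀ) *ᵥ lam) x = 0 := by
  have hv0 : vX D' cq x = 0 := by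
    have : uFun ℓ Mh cq.1 cq.2 x.1 = 0 := hux
    show vFun D' cq.1 cq.2 x.1 = 0
    unfold vFun; rw [this, zero_mul]
  have hrow : ∀ x', ((aX D' a c hP cq hc)ᵀ * (dMat (N0 ℓ Mh k P) μ)ᵀ) x x' = 0 := by
    intro x'
    by_cases hxe : x'.1 + Pi.single μ 1 ∈ boxDom (N0 ℓ Mh k P)
    · rw [aXt_dMatt_apply hP cq hc μ x x' hxe, hv0, zero_mul]
    · exact aXt_dMatt_apply_off hP cq hc μ x x' hxe
  simp only [Matrix.mulVec, dotProduct, hrow, zero_mul, Finset.sum_const_zero]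

/-- **THE ROW SUPPORT OF A TRANSPORTED TERM OF `G′₀ᵀ∂ᵀ`**: a non-zero row at `x` keys the torus cube at `x`.
[cite: Balaban1984PropagatorsII, p.229 (cover of finite overlap), (2.37) p.229] -/
theorem mem_keySet_of_aTt_dTt_ne_zero (hℓ : 1 ≤ ℓ) (hR : 2 * (ℓ + 1) ≤ R) (hP : ∀ μ, 1 ≤ P μ) (hP4 : ∀ μ, 4 ≤ P μ)
    (hMh : 1 ≤ Mh) (cq : ℕ × (Fin (d + 1) → ℤ)) (hc : CubeDataT D cq) (μ : Fin (d + 1))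
    (lam : ↥(boxDom (N0 ℓ Mh k P)) → ℝ) {x : ↥(boxDom (N0 ℓ Mh k P))}
    (hz : (((aT D a c hP hP4 cq hc)ᵀ * (dT (N0 ℓ Mh k P) μ)ᵀ) *ᵥ lam) x ≠ 0) :
    (cq.1, Qmap ℓ Mh k P cq.1 x.1 cq.2) ∈ keySet ℓ Mh (D.lev x.1) x.1 := by
  rw [aTt_mul_dTt hMh hP hP4 cq hc μ, reindex_mulVec_apply] at hz
  have hux : uX (ℓ := ℓ) (Mh := Mh) (k := k) (P := P) (cq.1, qc ℓ k cq.1 cq.2) ((σc ℓ Mh k P cq.1 cq.2).symm x) ≠ 0 :=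
    fun h => hz (aXt_dMatt_mulVec_eq_zero hP _ (cubeData_chart hP4 hc) μ _ h)
  have hkey := mem_keySet_of_uX_ne_zero hℓ hR hP hMh _ (cubeData_chart hP4 hc) hux
  rw [Dc_lev_symm] at hkey
  exact mem_keySet_chart hMh hc.hj.2 hkey

/-- **THE MAJORANT OF `T̃₀ = Λ^{−1}G′₀ᵀ∂_μᵀ` FOR THE GENUINE `k`-LEVEL OPERATOR ON THE TORUS**: there are `δ₅, A > 0`
(functions of `d`, `ℓ`, windows) such that for every `k`, `M_h ≥ 3`, `R ≥ 2L`, torus size (`P_μ ≥ 4`), nested family `D`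
of domains of the torus, weights in the windows and axis `μ`, `T̃₀` has the majorant `A·e^{−δ₅d_T(y,y′)/(d+1)}` — per
transported term, in its chart, the box lineage's product rule on the column, the bond sums of `G′(□)∂*` and the rows of
`G′(□)` times `|∂h_□| ≤ (d+1)D₁/L^{j_□}`. [cite: Balaban1984PropagatorsII, (2.66)–(2.67) p.234 (third entry), (2.43) p.230] -/
theorem tZeroT_majorant (d ℓ : ℕ) (hℓ : 1 ≤ ℓ) (aminus aplus a2minus a2plus : ℝ) (ha : 0 < aminus)
    (ha2 : 0 < a2minus) :
    ∃ δ₅ A : ℝ, 0 < δ₅ ∧ 0 < A ∧ ∀ (k Mh R : ℕ), 3 ≤ Mh → 2 * (ℓ + 1) ≤ R →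
      ∀ (P : Fin (d + 1) → ℕ) (hP : ∀ μ, 1 ≤ P μ) (hP4 : ∀ μ, 4 ≤ P μ) (D : TDomains d ℓ Mh k P R) (a c : ℕ → ℝ),
        (∀ i, 1 ≤ i → aminus ≤ a i ∧ a i ≤ aplus) → (∀ i, 1 ≤ i → a2minus ≤ c i ∧ c i ≤ a2plus) →
        ∀ μ : Fin (d + 1),
        HasMajorant (g := geomT D) (blkOf D.toDomains)
          (Matrix.toLin' (levW D.toDomains (-1) * (gZeroT D a c hP hP4)ᵀ * (dT (N0 ℓ Mh k P) μ)ᵀ))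
          (fun y y' => A * Real.exp (-(δ₅ / (d + 1) * (geomT D).dist y y'))) := by
  obtain ⟨δa, c', hδa, hc', h243⟩ := ineq243_twoLevel_roww d ℓ hℓ aminus aplus 0 a2minus a2plus ha ha2
  obtain ⟨δb, cs, hδb, hcs, h243s⟩ := ineq243_twoLevel_dstar_roww d ℓ hℓ aminus aplus 0 a2minus a2plus ha ha2
  have hD1 := D1_nonneg contDiff_hprof hasCompactSupport_hprof
  obtain ⟨δ, hδdef⟩ : ∃ δ : ℝ, δ = min δa δb := ⟨_, rfl⟩
  have hδ0 : 0 < δ := by rw [hδdef]; exact lt_min hδa hδb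
  have hδa' : δ ≤ δa := by rw [hδdef]; exact min_le_left _ _
  have hδb' : δ ≤ δb := by rw [hδdef]; exact min_le_right _ _
  have hL0 : (0 : ℝ) < (ℓ : ℝ) + 1 := by positivity
  have hL1 : (1 : ℝ) ≤ (ℓ : ℝ) + 1 := by linarith [(Nat.cast_nonneg ℓ : (0 : ℝ) ≤ ℓ)]
  obtain ⟨Q, hQ⟩ : ∃ Q : ℝ, Q = ((d + 1) * D1 hprof * c' + cs) * Real.exp δ := ⟨_, rfl⟩
  have hQ0 : 0 ≤ Q := by rw [hQ]; positivity
  refine ⟨δ, 3 * 2 ^ (d + 1) * Q + 1, hδ0, by positivity, ?_⟩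
  intro k Mh R hMh hR P hP hP4 D a c haw hcw μ y' lam B hlam x
  have hMh1 : 1 ≤ Mh := le_trans (by norm_num) hMh
  have hB0 : 0 ≤ B := hlam.nonneg
  rw [Matrix.toLin'_apply, Matrix.mul_assoc, ← Matrix.mulVec_mulVec]
  unfold levW
  rw [Matrix.mulVec_diagonal, abs_mul]
  have hpow : |((((ℓ : ℝ) + 1) ^ D.toDomains.lev x.1) ^ (-1 : ℤ))| = (((ℓ : ℝ) + 1) ^ D.lev x.1)⁻¹ := by
    rw [_root_.zpow_neg_one, abs_of_nonneg (by positivity), TDomains.toDomains_lev]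
  rw [hpow]
  set dist0 : ℝ := (((bondT D).dist (blkOf D.toDomains x) y' : ℕ) : ℝ) with hdist0
  have hgeom : (geomT D).dist (blkOf D.toDomains x) y' = dist0 := rfl
  have hdist0nn : 0 ≤ dist0 := by positivity
  -- THE BOX LINEAGE'S BOUND OF ONE TERM, for ANY family on the fundamental box (file 9's per-cube argument)
  have hbox : ∀ (D' : Domains d ℓ Mh k P R) (y'' : ↥(bset D')) (lam' : ↥(boxDom (N0 ℓ Mh k P)) → ℝ),
      BlockSupp (g := geom D') (blkOf D') lam' y'' B →
      ∀ (x' : ↥(boxDom (N0 ℓ Mh k P))) (cq : ℕ × (Fin (d + 1) → ℤ)) (hc : CubeData D' cq),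
        |(((aX D' a c hP cq hc)ᵀ * (dMat (N0 ℓ Mh k P) μ)ᵀ) *ᵥ lam') x'|
          ≤ ((ℓ : ℝ) + 1) ^ D'.lev x'.1
            * (Q * Real.exp (-(δ / (d + 1) * (((bond D').dist (blkOf D' x') y'' : ℕ) : ℝ))) * B) := by
    intro D' y'' lam' hlam' x' cq hc
    have hlamB : ∀ w, |lam' w| ≤ B := fun w => BlockSupp.abs_le hlam' w
    set dist1 : ℝ := (((bond D').dist (blkOf D' x') y'' : ℕ) : ℝ) with hdist1
    set E1 : ℝ := ((ℓ : ℝ) + 1) ^ D'.lev x'.1 * (Q * Real.exp (-(δ / (d + 1) * dist1)) * B) with hE1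
    have hE10 : 0 ≤ E1 := by positivity
    obtain ⟨hi1, hij, hji, -, -⟩ := fin_data hc
    have hjk := hc.hj.2
    -- `v_□(x′) = 0` kills the term; otherwise `x′` lies in the cube image
    by_cases hvx : uX (ℓ := ℓ) (Mh := Mh) (k := k) (P := P) cq x' = 0
    · rw [aXt_dMatt_mulVec_eq_zero hP cq hc μ lam' hvx, abs_zero]; exact hE10
    obtain ⟨y, hy⟩ := img_of_uX_ne_zero hℓ hP hMh1 cq hc hvx (Or.inr rfl)
    have hzval : ∀ w : ↥(boxDom (N0 ℓ Mh k P)), ((castP (ℓ := ℓ) (Mh := Mh) (P := P) hij hjk).symm w).1 = w.1 :=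
      fun w => by unfold castP; exact boxCast_symm_apply_val _ _
    have hyx : (embC D' hP cq hc y).1 = x'.1 := by rw [hy, hzval]
    have hxin : InCube ℓ Mh k P cq.1 cq.2 x'.1 := by
      rw [← hzval x']; exact (inCube_iff_exists_emb (Mh := Mh) hP hij hc.hq _).2 ⟨y, hy⟩
    have hlevwin := lev_window_of_inCube hℓ hR hP hMh1 hc x'.2 hxin
    have hMh' : 1 ≤ MhP ℓ Mh cq.1 (fin D' cq.1 cq.2) := one_le_MhP hMh1 _ _
    have hcM' : ∀ ν, 1 ≤ cubeM' (MhP ℓ Mh cq.1 (fin D' cq.1 cq.2)) (Pj ℓ k P cq.1) cq.2 ν := fun ν =>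
      Nat.one_le_iff_ne_zero.2 (Nat.mul_ne_zero_iff.2
        ⟨by omega, by have := (one_le_cubeW (one_le_Pj hP cq.1) hc.hq ν).1; omega⟩)
    have hn1 : 1 ≤ (ℓ + 1) ^ fin D' cq.1 cq.2 := Nat.one_le_pow _ _ (by omega)
    have hn : (0 : ℝ) < (((ℓ + 1) ^ fin D' cq.1 cq.2 : ℕ) : ℝ) := by positivity
    have hncast : (((ℓ + 1) ^ fin D' cq.1 cq.2 : ℕ) : ℝ) = ((ℓ : ℝ) + 1) ^ fin D' cq.1 cq.2 := by push_cast; ring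
    obtain ⟨nn, hnn⟩ : ∃ t : ℝ, t = (((ℓ + 1) ^ fin D' cq.1 cq.2 : ℕ) : ℝ) := ⟨_, rfl⟩
    have hnn0 : 0 < nn := by rw [hnn]; exact hn
    have hnnle : nn ≤ ((ℓ : ℝ) + 1) ^ D'.lev x'.1 := by rw [hnn, hncast]; exact pow_le_pow_right₀ hL1 hlevwin.1
    have hNj1 : 1 ≤ (ℓ + 1) ^ cq.1 := Nat.one_le_pow _ _ (by omega)
    have hM1 : 1 ≤ (ℓ + 1) * Mh := by nlinarith
    set Dd : ℝ := nn * (dist1 / (d + 1) - 1) with hDd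
    -- the row data of the cube
    have hrow : roww δ ((ℓ + 1) ^ fin D' cq.1 cq.2) (cG D' a c cq.1 (fin D' cq.1 cq.2) cq.2 hP hc.hq) y ≤ c' :=
      (roww_mono hδa' _ _ _).trans (h243 (fin D' cq.1 cq.2) hi1 (a (fin D' cq.1 cq.2)) 0 (c (fin D' cq.1 cq.2))
        (haw _ hi1).1 (haw _ hi1).2 le_rfl le_rfl (hcw _ hi1).1 (hcw _ hi1).2 _ hcM' _ y)
    have hrowd : roww δ ((ℓ + 1) ^ fin D' cq.1 cq.2)
        (dstar ((ℓ + 1) ^ fin D' cq.1 cq.2) μ (cG D' a c cq.1 (fin D' cq.1 cq.2) cq.2 hP hc.hq)) y ≤ cs :=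
      (roww_mono hδb' _ _ _).trans (h243s (fin D' cq.1 cq.2) hi1 (a (fin D' cq.1 cq.2)) 0 (c (fin D' cq.1 cq.2))
        (haw _ hi1).1 (haw _ hi1).2 le_rfl le_rfl (hcw _ hi1).1 (hcw _ hi1).2 _ hcM'
        (lamLoc ℓ (MhP ℓ Mh cq.1 (fin D' cq.1 cq.2)) (Pj ℓ k P cq.1) cq.2 (one_le_Pj hP cq.1) hc.hq
          (LamG D' cq.1 (fin D' cq.1 cq.2))) μ y)
    set r : ↥(Box d ℓ (fin D' cq.1 cq.2)
        (fun μ => (ℓ + 1) * cubeM' (MhP ℓ Mh cq.1 (fin D' cq.1 cq.2)) (Pj ℓ k P cq.1) cq.2 μ)) → ℝ :=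
      fun b => (d + 1) * D1 hprof * nn * |cG D' a c cq.1 (fin D' cq.1 cq.2) cq.2 hP hc.hq y b|
        + nn * |dstar ((ℓ + 1) ^ fin D' cq.1 cq.2) μ (cG D' a c cq.1 (fin D' cq.1 cq.2) cq.2 hP hc.hq) y b| with hr
    have hr0 : ∀ b, 0 ≤ r b := fun b => by positivity
    have hwrow : ∑ b, |r b| * Real.exp (δ * supNorm (y.1 - b.1) / nn)
        ≤ nn * ((d + 1) * D1 hprof * c' + cs) := by
      have hsplit : ∀ b, |r b| * Real.exp (δ * supNorm (y.1 - b.1) / nn)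
          = (d + 1) * D1 hprof * nn * (|cG D' a c cq.1 (fin D' cq.1 cq.2) cq.2 hP hc.hq y b|
              * Real.exp (δ * supNorm (y.1 - b.1) / nn))
            + nn * (|dstar ((ℓ + 1) ^ fin D' cq.1 cq.2) μ (cG D' a c cq.1 (fin D' cq.1 cq.2) cq.2 hP hc.hq) y b|
              * Real.exp (δ * supNorm (y.1 - b.1) / nn)) := by
        intro b
        rw [abs_of_nonneg (hr0 b), hr]
        ring
      simp_rw [hsplit]
      rw [Finset.sum_add_distrib, ← Finset.mul_sum, ← Finset.mul_sum]
      have h1 : ∑ b, |cG D' a c cq.1 (fin D' cq.1 cq.2) cq.2 hP hc.hq y b| * Real.exp (δ * supNorm (y.1 - b.1) / nn)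
          ≤ c' := by rw [hnn]; exact hrow
      have h2 : ∑ b, |dstar ((ℓ + 1) ^ fin D' cq.1 cq.2) μ (cG D' a c cq.1 (fin D' cq.1 cq.2) cq.2 hP hc.hq) y b|
          * Real.exp (δ * supNorm (y.1 - b.1) / nn) ≤ cs := by rw [hnn]; exact hrowd
      calc (d + 1) * D1 hprof * nn * ∑ b, |cG D' a c cq.1 (fin D' cq.1 cq.2) cq.2 hP hc.hq y b|
              * Real.exp (δ * supNorm (y.1 - b.1) / nn)
            + nn * ∑ b, |dstar ((ℓ + 1) ^ fin D' cq.1 cq.2) μ (cG D' a c cq.1 (fin D' cq.1 cq.2) cq.2 hP hc.hq) y b|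
              * Real.exp (δ * supNorm (y.1 - b.1) / nn)
          ≤ (d + 1) * D1 hprof * nn * c' + nn * cs :=
            add_le_add (mul_le_mul_of_nonneg_left h1 (by positivity)) (mul_le_mul_of_nonneg_left h2 hnn0.le)
        _ = nn * ((d + 1) * D1 hprof * c' + cs) := by ring
    -- the entries off the image vanish, on the image they are bounded by `|v(x′)|·r(b)`
    have hent_off : ∀ x'', (∀ b, castP (fin_data hc).2.1 hc.hj.2 (embC D' hP cq hc b) ≠ x'') →
        ((aX D' a c hP cq hc)ᵀ * (dMat (N0 ℓ Mh k P) μ)ᵀ) x' x'' = 0 := by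
      intro x'' hx''
      have hx3 : ∀ b, embC D' hP cq hc b ≠ (castP (ℓ := ℓ) (Mh := Mh) (P := P) hij hjk).symm x'' := by
        intro b hb; exact hx'' b (by rw [hb, Equiv.apply_symm_apply])
      by_cases hxe : x''.1 + Pi.single μ 1 ∈ boxDom (N0 ℓ Mh k P)
      · rw [aXt_dMatt_apply hP cq hc μ x' x'' hxe, gX_apply_off hP cq hc hx3]
        have hu0 : uX (ℓ := ℓ) (Mh := Mh) (k := k) (P := P) cq ⟨x''.1 + Pi.single μ 1, hxe⟩ = 0 := by
          by_contra hu
          obtain ⟨b, hb⟩ := img_of_uX_ne_zero hℓ hP hMh1 cq hc hu (w := x'')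
            (Or.inl (mem_nbrs.2 ⟨μ, Or.inr (by simp)⟩))
          exact hx3 b hb
        rw [hu0]; ring
      · exact aXt_dMatt_apply_off hP cq hc μ x' x'' hxe
    have hent_img : ∀ b, |((aX D' a c hP cq hc)ᵀ * (dMat (N0 ℓ Mh k P) μ)ᵀ) x'
        (castP (fin_data hc).2.1 hc.hj.2 (embC D' hP cq hc b))| ≤ |vX D' cq x'| * r b := by
      intro b
      set x'' : ↥(boxDom (N0 ℓ Mh k P)) := castP (fin_data hc).2.1 hc.hj.2 (embC D' hP cq hc b) with hx''
      have hb : embC D' hP cq hc b = (castP (ℓ := ℓ) (Mh := Mh) (P := P) hij hjk).symm x'' := by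
        rw [hx'', Equiv.symm_apply_apply]
      have hx''val : x''.1 = (embC D' hP cq hc b).1 := by rw [hx'']; unfold castP; exact boxCast_apply_val _ _
      by_cases hxe : x''.1 + Pi.single μ 1 ∈ boxDom (N0 ℓ Mh k P)
      swap
      · rw [aXt_dMatt_apply_off hP cq hc μ x' x'' hxe, abs_zero]; exact mul_nonneg (abs_nonneg _) (hr0 b)
      rw [aXt_dMatt_apply hP cq hc μ x' x'' hxe, gX_apply_img hP cq hc hy hb, abs_mul]
      refine mul_le_mul_of_nonneg_left ?_ (abs_nonneg _)
      have hdu : |uX (ℓ := ℓ) (Mh := Mh) (k := k) (P := P) cq ⟨x''.1 + Pi.single μ 1, hxe⟩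
          - uX (ℓ := ℓ) (Mh := Mh) (k := k) (P := P) cq x''| ≤ (d + 1) * D1 hprof / (((ℓ + 1) ^ cq.1 : ℕ) : ℝ) := by
        have h := abs_hq_sub_le (d := d) hNj1 hM1 cq.2 x''.1 (x''.1 + Pi.single μ 1)
        have hs : supNorm (x''.1 + Pi.single μ 1 - x''.1) ≤ 1 := by
          rw [add_sub_cancel_left]; exact supNorm_single_le μ
        have hMr : (1 : ℝ) ≤ (((ℓ + 1) * Mh : ℕ) : ℝ) := by exact_mod_cast hM1
        have hnj : (0 : ℝ) < (((ℓ + 1) ^ cq.1 : ℕ) : ℝ) := by positivity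
        have hA0 : 0 ≤ (d + 1) * D1 hprof / (((ℓ + 1) * Mh : ℕ) : ℝ) := by positivity
        have h5 : (d + 1) * D1 hprof / (((ℓ + 1) * Mh : ℕ) : ℝ) * supNorm (x''.1 + Pi.single μ 1 - x''.1)
            ≤ (d + 1) * D1 hprof :=
          calc (d + 1) * D1 hprof / (((ℓ + 1) * Mh : ℕ) : ℝ) * supNorm (x''.1 + Pi.single μ 1 - x''.1)
              ≤ (d + 1) * D1 hprof / (((ℓ + 1) * Mh : ℕ) : ℝ) * 1 := mul_le_mul_of_nonneg_left hs hA0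
            _ = (d + 1) * D1 hprof / (((ℓ + 1) * Mh : ℕ) : ℝ) := mul_one _
            _ ≤ (d + 1) * D1 hprof := div_le_self (by positivity) hMr
        exact h.trans (div_le_div_of_nonneg_right h5 hnj.le)
      have hsq : nn * nn / (((ℓ + 1) ^ cq.1 : ℕ) : ℝ) ≤ nn := by
        have hnj : (0 : ℝ) < (((ℓ + 1) ^ cq.1 : ℕ) : ℝ) := by positivity
        rw [div_le_iff₀ hnj]
        refine mul_le_mul_of_nonneg_left ?_ hnn0.le
        rw [hnn]; exact_mod_cast Nat.pow_le_pow_right (by omega) hij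
      have hn2eq : ((((ℓ : ℝ) + 1)) ^ fin D' cq.1 cq.2) ^ 2 = nn * nn := by rw [hnn, hncast]; ring
      have hp1 : |(uX (ℓ := ℓ) (Mh := Mh) (k := k) (P := P) cq ⟨x''.1 + Pi.single μ 1, hxe⟩
            - uX (ℓ := ℓ) (Mh := Mh) (k := k) (P := P) cq x'')
          * (((((ℓ : ℝ) + 1)) ^ fin D' cq.1 cq.2) ^ 2 * cG D' a c cq.1 (fin D' cq.1 cq.2) cq.2 hP hc.hq y b)|
          ≤ (d + 1) * D1 hprof * nn * |cG D' a c cq.1 (fin D' cq.1 cq.2) cq.2 hP hc.hq y b| := by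
        rw [abs_mul, abs_mul, hn2eq, abs_of_nonneg (mul_nonneg hnn0.le hnn0.le)]
        have hnj : (0 : ℝ) < (((ℓ + 1) ^ cq.1 : ℕ) : ℝ) := by positivity
        calc |uX cq ⟨x''.1 + Pi.single μ 1, hxe⟩ - uX cq x''| * (nn * nn * |cG D' a c cq.1 (fin D' cq.1 cq.2) cq.2 hP hc.hq y b|)
            ≤ (d + 1) * D1 hprof / (((ℓ + 1) ^ cq.1 : ℕ) : ℝ)
                * (nn * nn * |cG D' a c cq.1 (fin D' cq.1 cq.2) cq.2 hP hc.hq y b|) :=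
              mul_le_mul_of_nonneg_right hdu (by positivity)
          _ = (d + 1) * D1 hprof * (nn * nn / (((ℓ + 1) ^ cq.1 : ℕ) : ℝ))
                * |cG D' a c cq.1 (fin D' cq.1 cq.2) cq.2 hP hc.hq y b| := by
              field_simp
          _ ≤ (d + 1) * D1 hprof * nn * |cG D' a c cq.1 (fin D' cq.1 cq.2) cq.2 hP hc.hq y b| :=
              mul_le_mul_of_nonneg_right (mul_le_mul_of_nonneg_left hsq (by positivity)) (abs_nonneg _)
      have hp2 : |uX (ℓ := ℓ) (Mh := Mh) (k := k) (P := P) cq ⟨x''.1 + Pi.single μ 1, hxe⟩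
          * (gX D' a c hP cq hc x' ⟨x''.1 + Pi.single μ 1, hxe⟩
            - ((((ℓ : ℝ) + 1)) ^ fin D' cq.1 cq.2) ^ 2 * cG D' a c cq.1 (fin D' cq.1 cq.2) cq.2 hP hc.hq y b)|
          ≤ nn * |dstar ((ℓ + 1) ^ fin D' cq.1 cq.2) μ (cG D' a c cq.1 (fin D' cq.1 cq.2) cq.2 hP hc.hq) y b| := by
        by_cases hu : uX (ℓ := ℓ) (Mh := Mh) (k := k) (P := P) cq ⟨x''.1 + Pi.single μ 1, hxe⟩ = 0
        · rw [hu, zero_mul, abs_zero]; exact mul_nonneg hnn0.le (abs_nonneg _)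
        obtain ⟨be, hbe⟩ := img_of_uX_ne_zero hℓ hP hMh1 cq hc hu (Or.inr rfl)
        have hbeval : (embC D' hP cq hc be).1 = x''.1 + Pi.single μ 1 := by rw [hbe, hzval]
        have hbe1 : be.1 = b.1 + Pi.single μ 1 := by
          have h1 : (embC D' hP cq hc be).1 - (embC D' hP cq hc b).1 = be.1 - b.1 := by
            unfold embC; exact emb_sub_emb _ hc.hq be b
          rw [hbeval, ← hx''val, add_sub_cancel_left, eq_comm, sub_eq_iff_eq_add'] at h1
          exact h1
        have hfwd : fwd _ μ b = be := fwd_eq_of_nbr μ b be hbe1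
        rw [gX_apply_img hP cq hc hy hbe, ← mul_sub, dstar_apply, hfwd, abs_mul, abs_mul, abs_mul, hn2eq,
          abs_of_nonneg (mul_nonneg hnn0.le hnn0.le), hnn, abs_of_nonneg hn.le]
        have huXe : |uX (ℓ := ℓ) (Mh := Mh) (k := k) (P := P) cq ⟨x''.1 + Pi.single μ 1, hxe⟩| ≤ 1 :=
          abs_hq_le_one _ _ _ _
        calc |uX cq ⟨x''.1 + Pi.single μ 1, hxe⟩|
              * ((((ℓ + 1) ^ fin D' cq.1 cq.2 : ℕ) : ℝ) * (((ℓ + 1) ^ fin D' cq.1 cq.2 : ℕ) : ℝ)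
                * |cG D' a c cq.1 (fin D' cq.1 cq.2) cq.2 hP hc.hq y be - cG D' a c cq.1 (fin D' cq.1 cq.2) cq.2 hP hc.hq y b|)
            ≤ 1 * ((((ℓ + 1) ^ fin D' cq.1 cq.2 : ℕ) : ℝ) * (((ℓ + 1) ^ fin D' cq.1 cq.2 : ℕ) : ℝ)
                * |cG D' a c cq.1 (fin D' cq.1 cq.2) cq.2 hP hc.hq y be - cG D' a c cq.1 (fin D' cq.1 cq.2) cq.2 hP hc.hq y b|) :=
              mul_le_mul_of_nonneg_right huXe (by positivity)
          _ = (((ℓ + 1) ^ fin D' cq.1 cq.2 : ℕ) : ℝ) * ((((ℓ + 1) ^ fin D' cq.1 cq.2 : ℕ) : ℝ)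
                * |cG D' a c cq.1 (fin D' cq.1 cq.2) cq.2 hP hc.hq y be - cG D' a c cq.1 (fin D' cq.1 cq.2) cq.2 hP hc.hq y b|) := by
              ring
      refine (abs_add_le _ _).trans ?_
      rw [hr]
      exact add_le_add hp1 hp2
    -- the row applied to `λ′`: a sum over the cube, weighted decay against the block support
    have hsumx : (((aX D' a c hP cq hc)ᵀ * (dMat (N0 ℓ Mh k P) μ)ᵀ) *ᵥ lam') x'
        = ∑ b, ((aX D' a c hP cq hc)ᵀ * (dMat (N0 ℓ Mh k P) μ)ᵀ) x' (castP (fin_data hc).2.1 hc.hj.2 (embC D' hP cq hc b))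
            * lam' (castP (fin_data hc).2.1 hc.hj.2 (embC D' hP cq hc b)) := by
      simp only [Matrix.mulVec, dotProduct]
      exact sum_eq_sum_cube hP cq hc _ fun x'' hx'' => by rw [hent_off x'' hx'', zero_mul]
    rw [hsumx]
    have hF : ∀ b, |(fun b => |lam' (castP (fin_data hc).2.1 hc.hj.2 (embC D' hP cq hc b))|) b| ≤ B := fun b => by
      simp only [abs_abs]; exact hlamB _
    have hD : ∀ b, (fun b => |lam' (castP (fin_data hc).2.1 hc.hj.2 (embC D' hP cq hc b))|) b ≠ 0 →
        Dd ≤ supNorm (y.1 - b.1) := by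
      intro b hb
      set x'' : ↥(boxDom (N0 ℓ Mh k P)) := castP (fin_data hc).2.1 hc.hj.2 (embC D' hP cq hc b) with hx''
      have hμx : lam' x'' ≠ 0 := fun h0 => hb (by
        show |lam' (castP (fin_data hc).2.1 hc.hj.2 (embC D' hP cq hc b))| = 0
        rw [← hx'', h0, abs_zero])
      have hx''val : x''.1 = (embC D' hP cq hc b).1 := by rw [hx'']; unfold castP; exact boxCast_apply_val _ _
      have hx''in : InCube ℓ Mh k P cq.1 cq.2 x''.1 := by
        rw [hx''val]; exact (inCube_iff_exists_emb (Mh := Mh) hP hij hc.hq _).2 ⟨b, rfl⟩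
      have hblk : blkOf D' x'' = y'' := by
        by_contra hne; exact hμx (hlam'.off x'' hne)
      have h := Dd_le_supNorm hℓ hR hP hMh1 hc x' x'' hxin hx''in y'' hblk
      have hsub : x'.1 - x''.1 = y.1 - b.1 := by
        rw [hx''val, ← hyx]; unfold embC; exact emb_sub_emb _ hc.hq y b
      rw [hsub] at h
      rw [hDd, hnn]
      exact h
    have hcol := sum_mul_le_of_wrow hnn0 hB0 r
      (fun b => |lam' (castP (fin_data hc).2.1 hc.hj.2 (embC D' hP cq hc b))|)
      (fun b => supNorm (y.1 - b.1)) hwrow hF hD hδ0.le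
    have hexp : Real.exp (-(δ * Dd / nn)) = Real.exp δ * Real.exp (-(δ / (d + 1) * dist1)) := by
      rw [hDd]; exact exp_Dd_eq hnn0 d
    rw [hexp] at hcol
    have hvX : |vX D' cq x'| ≤ 1 := abs_vFun_le_one _ _ _
    calc |∑ b, ((aX D' a c hP cq hc)ᵀ * (dMat (N0 ℓ Mh k P) μ)ᵀ) x' (castP (fin_data hc).2.1 hc.hj.2 (embC D' hP cq hc b))
            * lam' (castP (fin_data hc).2.1 hc.hj.2 (embC D' hP cq hc b))|
        ≤ ∑ b, |((aX D' a c hP cq hc)ᵀ * (dMat (N0 ℓ Mh k P) μ)ᵀ) x' (castP (fin_data hc).2.1 hc.hj.2 (embC D' hP cq hc b))|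
            * |lam' (castP (fin_data hc).2.1 hc.hj.2 (embC D' hP cq hc b))| := by
          refine (Finset.abs_sum_le_sum_abs _ _).trans (le_of_eq (Finset.sum_congr rfl fun b _ => abs_mul _ _))
      _ ≤ ∑ b, (|vX D' cq x'| * r b) * |lam' (castP (fin_data hc).2.1 hc.hj.2 (embC D' hP cq hc b))| :=
          Finset.sum_le_sum fun b _ => mul_le_mul_of_nonneg_right (hent_img b) (abs_nonneg _)
      _ = |vX D' cq x'| * ∑ b, r b * |lam' (castP (fin_data hc).2.1 hc.hj.2 (embC D' hP cq hc b))| := by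
          rw [Finset.mul_sum]; exact Finset.sum_congr rfl fun b _ => by ring
      _ ≤ 1 * (nn * ((d + 1) * D1 hprof * c' + cs) * (Real.exp δ * Real.exp (-(δ / (d + 1) * dist1))) * B) := by
          refine mul_le_mul hvX ((le_abs_self _).trans hcol) ?_ zero_le_one
          exact Finset.sum_nonneg fun b _ => mul_nonneg (hr0 b) (abs_nonneg _)
      _ ≤ E1 := by
          rw [one_mul, hE1, hQ]
          have : nn * ((d + 1) * D1 hprof * c' + cs) * (Real.exp δ * Real.exp (-(δ / (d + 1) * dist1))) * B
              = nn * ((((d + 1) * D1 hprof * c' + cs) * Real.exp δ) * Real.exp (-(δ / (d + 1) * dist1)) * B) := by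
            ring
          rw [this]
          exact mul_le_mul_of_nonneg_right hnnle (by positivity)
  -- the bound of one TORUS term: the box bound in its chart
  set E : ℝ := ((ℓ : ℝ) + 1) ^ D.lev x.1 * (Q * Real.exp (-(δ / (d + 1) * dist0)) * B) with hE
  have hE0 : 0 ≤ E := by positivity
  have hterm : ∀ (cq : ℕ × (Fin (d + 1) → ℤ)) (hc : CubeDataT D cq),
      |(((aT D a c hP hP4 cq hc)ᵀ * (dT (N0 ℓ Mh k P) μ)ᵀ) *ᵥ lam) x| ≤ E := by
    intro cq hc
    rw [aTt_mul_dTt hMh1 hP hP4 cq hc μ, reindex_mulVec_apply]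
    obtain ⟨b, hb⟩ := blkMap_surjective (D := D) hMh1 hP (svec ℓ k cq.1 cq.2) y'
    have hμ' : BlockSupp (g := geom (Dc D cq.1 cq.2)) (blkOf (Dc D cq.1 cq.2)) (lam ∘ σc ℓ Mh k P cq.1 cq.2) b B :=
      blockSupp_chart hMh1 hP (svec ℓ k cq.1 cq.2) hlam hb
    have h := hbox (Dc D cq.1 cq.2) b (lam ∘ σc ℓ Mh k P cq.1 cq.2) hμ' ((σc ℓ Mh k P cq.1 cq.2).symm x)
      (cq.1, qc ℓ k cq.1 cq.2) (cubeData_chart hP4 hc)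
    rw [Dc_lev_symm] at h
    refine h.trans ?_
    have hd : dist0 ≤ (((bond (Dc D cq.1 cq.2)).dist (blkOf (Dc D cq.1 cq.2) ((σc ℓ Mh k P cq.1 cq.2).symm x)) b
        : ℕ) : ℝ) := by
      rw [hdist0, ← hb]
      exact_mod_cast distT_blkOf_le_chart hMh1 hP (svec ℓ k cq.1 cq.2) x b
    rw [hE]
    have hexp : Real.exp (-(δ / (d + 1) * (((bond (Dc D cq.1 cq.2)).dist
          (blkOf (Dc D cq.1 cq.2) ((σc ℓ Mh k P cq.1 cq.2).symm x)) b : ℕ) : ℝ)))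
        ≤ Real.exp (-(δ / (d + 1) * dist0)) := by
      rw [Real.exp_le_exp, neg_le_neg_iff]
      exact mul_le_mul_of_nonneg_left hd (by positivity)
    exact mul_le_mul_of_nonneg_left (mul_le_mul_of_nonneg_right (mul_le_mul_of_nonneg_left hexp hQ0) hB0)
      (by positivity)
  -- summing over the cover
  unfold gZeroT
  rw [Matrix.transpose_sum, Finset.sum_mul, Matrix.sum_mulVec, Finset.sum_apply, Finset.attach_eq_univ]
  have key := sum_le_card_mul
    (fun cq : {cq // cq ∈ cubeSetT D} =>
      |(((aT D a c hP hP4 cq.1 (cubeDataT_of_mem cq.2))ᵀ * (dT (N0 ℓ Mh k P) μ)ᵀ) *ᵥ lam) x|)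
    (fun cq => (cq.1.1, Qmap ℓ Mh k P cq.1.1 x.1 cq.1.2)) (keyT_injective D x.1) (keySet ℓ Mh (D.lev x.1) x.1)
    (fun cq hq0 => mem_keySet_of_aTt_dTt_ne_zero hℓ hR hP hP4 hMh1 cq.1 (cubeDataT_of_mem cq.2) μ lam
      (fun h0 => hq0 (by rw [h0, abs_zero])))
    hE0 (fun cq => hterm cq.1 (cubeDataT_of_mem cq.2))
  refine (mul_le_mul_of_nonneg_left ((Finset.abs_sum_le_sum_abs _ _).trans key) (by positivity)).trans ?_
  have hcard : ((keySet ℓ Mh (D.lev x.1) x.1).card : ℝ) ≤ 3 * 2 ^ (d + 1) := by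
    exact_mod_cast card_keySet_le _ _ _ _
  dsimp only
  rw [hgeom]
  have hrest : 0 ≤ Real.exp (-(δ / (d + 1) * dist0)) * B := by positivity
  have hLpos : 0 < ((ℓ : ℝ) + 1) ^ D.lev x.1 := by positivity
  calc (((ℓ : ℝ) + 1) ^ D.lev x.1)⁻¹ * (((keySet ℓ Mh (D.lev x.1) x.1).card : ℝ) * E)
      ≤ (((ℓ : ℝ) + 1) ^ D.lev x.1)⁻¹ * (3 * 2 ^ (d + 1) * E) :=
        mul_le_mul_of_nonneg_left (mul_le_mul_of_nonneg_right hcard hE0) (by positivity)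
    _ = 3 * 2 ^ (d + 1) * Q * (Real.exp (-(δ / (d + 1) * dist0)) * B) := by
        rw [hE]; field_simp
    _ ≤ (3 * 2 ^ (d + 1) * Q + 1) * (Real.exp (-(δ / (d + 1) * dist0)) * B) :=
        mul_le_mul_of_nonneg_right (by linarith) hrest
    _ = (3 * 2 ^ (d + 1) * Q + 1) * Real.exp (-(δ / (d + 1) * dist0)) * B := by ring

end TZeroMajorant

/-! ## §5 Proposition 2.2, third entry, for the genuine `k`-level operator on the torus -/

section Prop22

variable {ℓ Mh k R : ℕ} {P : Fin (d + 1) → ℕ}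

/-- **[B6] PROPOSITION 2.2, THIRD ENTRY OF (2.67) (`G′∇^{η*}λ`), FOR THE GENUINE `k`-LEVEL OPERATOR `G′ = Δ′_a^{−1}` ON
THE TORUS `T_η`**: there are `δ₀, C, M₀ > 0` and `N₀ ≥ 1` (functions of `d`, `ℓ` and the windows — not of the torus) such
that for EVERY number of levels `k`, `M_h ≥ 3` with `L·M_h ≥ M₀` («M is sufficiently large»), `R ≥ 2L` with
`RM ≥ N₀ + 1` ((2.59)), torus size `P` (`P_μ ≥ 4`), nested family `D` of domains of the torus (2.1)–(2.2), weights
`a_i ∈ [a₋, a₊]`, `c_i ∈ [c₋, c₊]` with `a_{i+1} = aNext ℓ a_i c_i`, and every axis `μ`: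
`|(G′∂_μᵀλ)(x)| ≤ C·L^{j}·e^{−½δ₀d_T(y,y′)}·|λ|` for `x ∈ B^j(y)`, `y ∈ Λ_j`, `supp λ ⊂ B^{j′}(y′)` (`HasMajorant` of
`G′∂_μᵀ` on `geomT D`, `∂_μ` the periodic difference; lattice units: `L^{j}` for «L^jη») — by the transposed fixed point
`G′∂ᵀ = G′₀ᵀ∂ᵀ + Rᵀ(G′∂ᵀ)` conjugated by `Λ = diag(L^{j(x)})`, the invertibility of `1 − S` from its row sums
(`B6Prop23Chain.isUnit_one_sub`), the chain `B6Prop23Chain.majorant_of_fixedPoint_266W` for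
`(1 − S)^{−1} = 1 + (1 − S)^{−1}S`, the left convolution and Lemma 2.1 on the torus (file T3).
[cite: Balaban1984PropagatorsII, Proposition 2.2 (2.67) p.234 (third entry), (2.64)–(2.66) p.234, p.224 (Ω₁ = T_η admitted)] -/
theorem prop22_third_multiLevelTorus (d ℓ : ℕ) (hℓ : 1 ≤ ℓ) (aminus aplus a2minus a2plus : ℝ) (ha : 0 < aminus)
    (ha2 : 0 < a2minus) :
    ∃ δ₀ C M₀ : ℝ, ∃ N₀ : ℕ, 0 < δ₀ ∧ 0 < C ∧ 0 < M₀ ∧ 0 < N₀ ∧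
      ∀ (k Mh R : ℕ), 3 ≤ Mh → M₀ ≤ ((ℓ : ℝ) + 1) * Mh → 2 * (ℓ + 1) ≤ R → N₀ + 1 ≤ R * ((ℓ + 1) * Mh) →
      ∀ (P : Fin (d + 1) → ℕ) (hP : ∀ μ, 1 ≤ P μ) (hP4 : ∀ μ, 4 ≤ P μ) (D : TDomains d ℓ Mh k P R) (a c : ℕ → ℝ),
        (∀ i, 1 ≤ i → aminus ≤ a i ∧ a i ≤ aplus) → (∀ i, 1 ≤ i → a2minus ≤ c i ∧ c i ≤ a2plus) →
        (∀ i, 1 ≤ i → a (i + 1) = aNext ℓ (a i) (c i)) → ∀ μ : Fin (d + 1),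
        HasMajorant (g := geomT D) (blkOf D.toDomains)
          (Matrix.toLin' (gmlT (N0 ℓ Mh k P) ℓ k D.lev a * (dT (N0 ℓ Mh k P) μ)ᵀ))
          (fun y y' => C * ((ℓ : ℝ) + 1) ^ y.1.1 * Real.exp (-(δ₀ / 2 * (geomT D).dist y y'))) := by
  obtain ⟨δ₄, K', hδ₄, hK', hSmaj⟩ := sOpT_majorant d ℓ hℓ aminus aplus a2minus a2plus ha ha2
  obtain ⟨δ₅, A, hδ₅, hA, hTmaj⟩ := tZeroT_majorant d ℓ hℓ aminus aplus a2minus a2plus ha ha2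
  have hL0 : (0 : ℝ) < (ℓ : ℝ) + 1 := by positivity
  have hL1 : (1 : ℝ) ≤ (ℓ : ℝ) + 1 := by linarith [(Nat.cast_nonneg ℓ : (0 : ℝ) ≤ ℓ)]
  -- the rate `δ₀ = min(δ₄, δ₅)/(d+1)` and the (2.59)-threshold `N₀`
  set δ₀ : ℝ := min δ₄ δ₅ / (d + 1) with hδ₀
  have hδ₀pos : 0 < δ₀ := by rw [hδ₀]; exact div_pos (lt_min hδ₄ hδ₅) (by positivity)
  set N₀ : ℕ := ⌈4 * ((d : ℝ) + 1) * ((ℓ : ℝ) + 1) / (1 / 2 * δ₀)⌉₊ + 1 with hN₀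
  have hN₀pos : 0 < N₀ := by rw [hN₀]; omega
  have hθlt : Real.exp (-(1 / 2 * δ₀)) * ((ℓ : ℝ) + 1) ^ ((2 * (d + 1 : ℕ) : ℝ) / N₀) < 1 := by
    refine theta_lt_one_of_log hL0 hN₀pos ?_
    have hlog : Real.log ((ℓ : ℝ) + 1) ≤ (ℓ : ℝ) + 1 := (Real.log_le_sub_one_of_pos hL0).trans (by linarith)
    have hN₀ge : 4 * ((d : ℝ) + 1) * ((ℓ : ℝ) + 1) / (1 / 2 * δ₀) < (N₀ : ℝ) := by
      rw [hN₀]; push_cast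
      exact lt_of_le_of_lt (Nat.le_ceil _) (by linarith)
    have hσ : (0 : ℝ) < 1 / 2 * δ₀ := by positivity
    rw [div_lt_iff₀ hσ] at hN₀ge
    push_cast
    nlinarith [mul_nonneg (by positivity : (0 : ℝ) ≤ 2 * ((d : ℝ) + 1)) (Real.log_nonneg hL1)]
  -- the (2.61)-constant and «M sufficiently large» (`M_h ≥ 2K′c + 1`, stated through `L·M_h`)
  set cK : ℝ := K261 N₀ (d + 1) ((ℓ : ℝ) + 1) 1 (1 / 2 * δ₀) with hcK
  have hcK0 : 0 ≤ cK := K261_nonneg (by positivity) zero_le_one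
  set M₀ : ℝ := ((ℓ : ℝ) + 1) * (2 * K' * cK + 1) with hM₀
  refine ⟨δ₀, 2 * A * cK * cK + 1, M₀, N₀, hδ₀pos, by positivity, by positivity, hN₀pos, ?_⟩
  intro k Mh R hMh hM hR hRM P hP hP4 D a c haw hcw hac μ
  have hMh1 : 1 ≤ Mh := le_trans (by norm_num) hMh
  have hMhr : (1 : ℝ) ≤ Mh := by exact_mod_cast hMh1
  have hMh0 : (0 : ℝ) < Mh := by linarith
  have hMhge : 2 * K' * cK + 1 ≤ (Mh : ℝ) := le_of_mul_le_mul_left (by rw [hM₀] at hM; exact hM) hL0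
  have hapos : ∀ j, 1 ≤ j → 0 < a j := fun j hj => lt_of_lt_of_le ha (haw j hj).1
  have hcpos : ∀ j, 1 ≤ j → 0 < c j := fun j hj => lt_of_lt_of_le ha2 (hcw j hj).1
  -- geometry of the torus
  obtain ⟨-, h261, -, h263⟩ := lemma21_torus D hMh1 hP hN₀pos hRM hδ₀pos.le (α := 1 / 2) (by norm_num)
    (by norm_num) hθlt
  obtain ⟨htri, hrefl, hdnn⟩ := triangle_refl_nonneg_T D hMh1 hP
  have hsymm : ∀ a b : (geomT D).Site, (geomT D).dist a b = (geomT D).dist b a := fun a b => by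
    show (((bondT D).dist a b : ℕ) : ℝ) = (((bondT D).dist b a : ℕ) : ℝ)
    rw [SimpleGraph.dist_comm]
  have hαδ : (0 : ℝ) ≤ (1 - 1 / 2) * δ₀ := by nlinarith [hδ₀pos.le]
  -- the majorants of `S` and `T̃₀` at the common rate `δ₀`
  set θ : ℝ := K' / Mh with hθ
  have hθ0 : 0 ≤ θ := by positivity
  have hrate : ∀ (δ : ℝ), min δ₄ δ₅ ≤ δ → ∀ y y' : (geomT D).Site,
      Real.exp (-(δ / (d + 1) * (geomT D).dist y y')) ≤ Real.exp (-(δ₀ * (geomT D).dist y y')) := by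
    intro δ hδ y y'
    rw [Real.exp_le_exp, hδ₀, neg_le_neg_iff]
    exact mul_le_mul_of_nonneg_right (div_le_div_of_nonneg_right hδ (by positivity)) (hdnn y y')
  have hSm : HasMajorant (g := geomT D) (blkOf D.toDomains)
      (Matrix.toLin' (levW D.toDomains (-1) * (rT D a c hP hP4)ᵀ * levW D.toDomains 1))
      (fun y y' => θ * Real.exp (-(δ₀ * (geomT D).dist y y'))) :=
    hasMajorant_mono (blkOf D.toDomains) (hSmaj k Mh R hMh hR P hP hP4 D a c haw hcw) fun y y' =>
      mul_le_mul_of_nonneg_left (hrate δ₄ (min_le_left _ _) y y') hθ0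
  have hT0m : HasMajorant (g := geomT D) (blkOf D.toDomains)
      (Matrix.toLin' (levW D.toDomains (-1) * (gZeroT D a c hP hP4)ᵀ * (dT (N0 ℓ Mh k P) μ)ᵀ))
      (fun y y' => A * Real.exp (-(δ₀ * (geomT D).dist y y'))) :=
    hasMajorant_mono (blkOf D.toDomains) (hTmaj k Mh R hMh hR P hP hP4 D a c haw hcw μ) fun y y' =>
      mul_le_mul_of_nonneg_left (hrate δ₅ (min_le_right _ _) y y') hA.le
  -- the smallness `θ·c ≤ ½` and the row sums of `S`
  have hsmall : θ * cK ≤ 1 / 2 := by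
    rw [hθ, div_mul_eq_mul_div, div_le_iff₀ hMh0]
    nlinarith
  have hsmall' : θ * cK < 1 := by linarith
  have hrow : ∀ x, ∑ z, |mat (Matrix.toLin' (levW D.toDomains (-1) * (rT D a c hP hP4)ᵀ * levW D.toDomains 1)) x z|
      ≤ θ * cK := by
    intro x
    simp_rw [mat_toLin']
    refine (rowSum_le_of_hasMajorant (g := geomT D) (blkOf D.toDomains) hSm x).trans ?_
    calc ∑ y' : (geomT D).Site, θ * Real.exp (-(δ₀ * (geomT D).dist (blkOf D.toDomains x) y'))
        ≤ ∑ y' : (geomT D).Site, θ * Real.exp (-(1 / 2 * δ₀ * (geomT D).dist (blkOf D.toDomains x) y')) :=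
          Finset.sum_le_sum fun y' _ => mul_le_mul_of_nonneg_left
            (Real.exp_le_exp.2 (by nlinarith [hdnn (blkOf D.toDomains x) y', hδ₀pos.le])) hθ0
      _ = θ * ∑ y' : (geomT D).Site, Real.exp (-(1 / 2 * δ₀ * (geomT D).dist (blkOf D.toDomains x) y')) := by
          rw [Finset.mul_sum]
      _ ≤ θ * cK := mul_le_mul_of_nonneg_left (h261 (blkOf D.toDomains x)) hθ0
  -- `U = (1 − S)^{−1} = 1 + U·S` and its majorant from the chain
  obtain ⟨u, hu⟩ := isUnit_one_sub hsmall' hrow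
  set U : Module.End ℝ (↥(boxDom (N0 ℓ Mh k P)) → ℝ) := ↑u⁻¹ with hUdef
  have hUinv : U * (1 - Matrix.toLin' (levW D.toDomains (-1) * (rT D a c hP hP4)ᵀ * levW D.toDomains 1)) = 1 := by
    rw [hUdef, ← hu, Units.inv_mul]
  have hfixU : U = 1 + U * Matrix.toLin' (levW D.toDomains (-1) * (rT D a c hP hP4)ᵀ * levW D.toDomains 1) := by
    have h := hUinv
    rw [mul_sub, mul_one, sub_eq_iff_eq_add] at h
    exact h
  have hUmaj := majorant_of_fixedPoint_266W (g := geomT D) (blkOf D.toDomains) cK δ₀ (1 / 2) θ 1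
    (fun _ => (1 : ℝ)) zero_le_one (fun _ => zero_le_one) hθ0 hcK0 hαδ htri hrefl hdnn h261 h263 hsmall'
    (hasMajorant_one (blkOf D.toDomains) δ₀ hrefl) hSm hfixU
  have hUmaj' : HasMajorant (g := geomT D) (blkOf D.toDomains) U
      (fun y y' => cK * (1 - θ * cK)⁻¹ * Real.exp (-((1 - 1 / 2) * δ₀ * (geomT D).dist y y'))) :=
    hasMajorant_mono (g := geomT D) (blkOf D.toDomains) hUmaj fun y y' => le_of_eq (by ring)
  -- `T̃ = U·T̃₀`
  have hconj := fixedPoint_conjT D (c := c) hℓ hR hP hP4 hMh1 hapos hcpos hac (dT (N0 ℓ Mh k P) μ)ᵀ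
  have hconjL : Matrix.toLin' (levW D.toDomains (-1) * (gmlT (N0 ℓ Mh k P) ℓ k D.lev a * (dT (N0 ℓ Mh k P) μ)ᵀ))
      = Matrix.toLin' (levW D.toDomains (-1) * (gZeroT D a c hP hP4)ᵀ * (dT (N0 ℓ Mh k P) μ)ᵀ)
        + Matrix.toLin' (levW D.toDomains (-1) * (rT D a c hP hP4)ᵀ * levW D.toDomains 1)
          * Matrix.toLin' (levW D.toDomains (-1) * (gmlT (N0 ℓ Mh k P) ℓ k D.lev a * (dT (N0 ℓ Mh k P) μ)ᵀ)) := by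
    conv_lhs => rw [hconj]
    rw [map_add, Module.End.mul_eq_comp, ← Matrix.toLin'_mul,
      Matrix.mul_assoc (levW D.toDomains (-1)) ((gZeroT D a c hP hP4)ᵀ)]
  have hTt : Matrix.toLin' (levW D.toDomains (-1) * (gmlT (N0 ℓ Mh k P) ℓ k D.lev a * (dT (N0 ℓ Mh k P) μ)ᵀ))
      = U * Matrix.toLin' (levW D.toDomains (-1) * (gZeroT D a c hP hP4)ᵀ * (dT (N0 ℓ Mh k P) μ)ᵀ) := by
    have h1 : (1 - Matrix.toLin' (levW D.toDomains (-1) * (rT D a c hP hP4)ᵀ * levW D.toDomains 1))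
        * Matrix.toLin' (levW D.toDomains (-1) * (gmlT (N0 ℓ Mh k P) ℓ k D.lev a * (dT (N0 ℓ Mh k P) μ)ᵀ))
        = Matrix.toLin' (levW D.toDomains (-1) * (gZeroT D a c hP hP4)ᵀ * (dT (N0 ℓ Mh k P) μ)ᵀ) := by
      rw [sub_mul, one_mul, sub_eq_iff_eq_add]
      exact hconjL
    calc Matrix.toLin' (levW D.toDomains (-1) * (gmlT (N0 ℓ Mh k P) ℓ k D.lev a * (dT (N0 ℓ Mh k P) μ)ᵀ))
        = (U * (1 - Matrix.toLin' (levW D.toDomains (-1) * (rT D a c hP hP4)ᵀ * levW D.toDomains 1)))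
            * Matrix.toLin' (levW D.toDomains (-1) * (gmlT (N0 ℓ Mh k P) ℓ k D.lev a * (dT (N0 ℓ Mh k P) μ)ᵀ)) := by
          rw [hUinv, one_mul]
      _ = U * Matrix.toLin' (levW D.toDomains (-1) * (gZeroT D a c hP hP4)ᵀ * (dT (N0 ℓ Mh k P) μ)ᵀ) := by
          rw [mul_assoc, h1]
  have hTtmaj : HasMajorant (g := geomT D) (blkOf D.toDomains)
      (Matrix.toLin' (levW D.toDomains (-1) * (gmlT (N0 ℓ Mh k P) ℓ k D.lev a * (dT (N0 ℓ Mh k P) μ)ᵀ)))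
      (fun y y' => cK * (1 - θ * cK)⁻¹ * A * cK * Real.exp (-((1 - 1 / 2) * δ₀ * (geomT D).dist y y'))) := by
    rw [hTt]
    exact majorant_mul_left (blkOf D.toDomains) hαδ htri hsymm h261 (by positivity) hA.le hUmaj' hT0m
  -- `T = Λ·T̃`
  have hT : gmlT (N0 ℓ Mh k P) ℓ k D.lev a * (dT (N0 ℓ Mh k P) μ)ᵀ
      = Matrix.diagonal (fun x => ((ℓ : ℝ) + 1) ^ (blkOf D.toDomains x).1.1)
        * (levW D.toDomains (-1) * (gmlT (N0 ℓ Mh k P) ℓ k D.lev a * (dT (N0 ℓ Mh k P) μ)ᵀ)) := by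
    rw [← levW_one_eq, ← Matrix.mul_assoc, levW_mul]
    norm_num
    rw [levW_zero, Matrix.one_mul]
  rw [hT]
  refine hasMajorant_mono (g := geomT D) (blkOf D.toDomains)
    (hasMajorant_diagonal_mul (g := geomT D) (blkOf D.toDomains) (fun y : ↥(bset D.toDomains) => ((ℓ : ℝ) + 1) ^ y.1.1)
      (fun y => by positivity) _ hTtmaj)
    fun y y' => ?_
  have hinv : (1 - θ * cK)⁻¹ ≤ 2 := by
    rw [inv_le_comm₀ (by linarith) (by norm_num)]; linarith
  have hrate2 : Real.exp (-((1 - 1 / 2) * δ₀ * (geomT D).dist y y'))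
      = Real.exp (-(δ₀ / 2 * (geomT D).dist y y')) := by
    congr 1; ring
  rw [hrate2]
  have hP0 : 0 ≤ ((ℓ : ℝ) + 1) ^ y.1.1 := by positivity
  have he0 : 0 ≤ Real.exp (-(δ₀ / 2 * (geomT D).dist y y')) := (Real.exp_pos _).le
  have h1 : cK * (1 - θ * cK)⁻¹ * A * cK ≤ 2 * A * cK * cK + 1 := by
    have : cK * (1 - θ * cK)⁻¹ * A * cK ≤ cK * 2 * A * cK :=
      mul_le_mul_of_nonneg_right (mul_le_mul_of_nonneg_right
        (mul_le_mul_of_nonneg_left hinv hcK0) hA.le) hcK0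
    linarith
  calc ((ℓ : ℝ) + 1) ^ y.1.1 * (cK * (1 - θ * cK)⁻¹ * A * cK * Real.exp (-(δ₀ / 2 * (geomT D).dist y y')))
      = cK * (1 - θ * cK)⁻¹ * A * cK * (((ℓ : ℝ) + 1) ^ y.1.1 * Real.exp (-(δ₀ / 2 * (geomT D).dist y y'))) := by
        ring
    _ ≤ (2 * A * cK * cK + 1) * (((ℓ : ℝ) + 1) ^ y.1.1 * Real.exp (-(δ₀ / 2 * (geomT D).dist y y'))) :=
        mul_le_mul_of_nonneg_right h1 (mul_nonneg hP0 he0)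
    _ = (2 * A * cK * cK + 1) * ((ℓ : ℝ) + 1) ^ y.1.1 * Real.exp (-(δ₀ / 2 * (geomT D).dist y y')) := by ring

end Prop22

end

end Literature.MathematicalPhysics.QuantumFieldTheory.Balaban1983to89.B6Prop22AdjMultiLevelTorus
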